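import Summits.AtomisticToContinuum.HydrodynamicLimit.Theses.JParityClosure
import Literature.Analysis.FluidPDE.HardSphereRegularGeometry
import Literature.MathematicalPhysics.KineticTheory.HardSphereEulerProofs
import Summits.AtomisticToContinuum.HydrodynamicLimit.Theorems.OddContactSymmetry.Negative.ParityExactWeights
import Summits.AtomisticToContinuum.HydrodynamicLimit.Theorems.LocalSecondLaw.Negative.HomogeneousLLN
import Summits.AtomisticToContinuum.HydrodynamicLimit.Theorems.DenseExcursion.Negative.Untied
import Summits.AtomisticToContinuum.HydrodynamicLimit.Theorems.HydroLimitInBand.Negative.ShearReduction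

/-!
# Disproof work file for crux `JParityClosure.OddContactSymmetry` — rev 5, item stmt-AtomisticToContinuum-17722
# (history: rev 1–4 = retired item stmt-AtomisticToContinuum-13078, §1–§8)

Standing adversary of the RESTATED crux: `refuter-cdisprove-stmt-AtomisticToContinuum-17722-0`, cycle 1 (2026-08-17, §9).
Earlier seats on the retired filing: `refuter-cdisprove-stmt-AtomisticToContinuum-13078-0` (cycle 1, §1–§7) and
`refuter-cdisprove-stmt-AtomisticToContinuum-13078-g2-0` (cycle 2, §8), both 2026-08-16.

REV-5 VERDICT (cycle 1, §9): **no kill; the restated crux (Metropolis weight `min 1 (e^{−F})` + pre-shock frame) survives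
every cheap attack.**  What rev 5 changed, read back from the `let`-chain: `e^{−F} = hm(v⁺)hm(w⁺)/(hm(v⁻)hm(w⁻))` has the
CURRENT (post-collisional, self-spiked) velocities in the numerator and the reflected PRE-velocities — atoms of nothing — in
the denominator, so the velocity-hole blow-up of §7 (tiny `hm(v⁻)`) now only drives `e^{−F} → ∞`, clipped at `1`: the §7/§8.1
mechanism that killed rev 1–4 is GONE (`|Ψ·min(1,e^{−F})| ≤ C`, tightness = collision-count tightness).  What rev 5 did NOT
change (§9.3, landed `Negative/MetropolisMixture`): `min` is parity-exact, so the limit content at FIXED `(r,ϑ)` is still the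
twisted balance `a b′ = a′ b`, false for `r`-ball mixtures under perfect local equilibrium
(`metropolis_residual_ne_zero_of_mixture`) — the order `∀ η δ, ∃ r₀(η,δ)` is load-bearing and `γ̄_a = 0` is read only after
`r → 0`.  What the new FRAME buys (§9.2, landed `Negative/RungZeroFrame`, `Negative/ShearFrame`): NOTHING at global
equilibrium and NOTHING along the stationary shear flow — both discharge the classical solution, the `t = 0` LLN and `τ < T`
in tree for EVERY horizon (`oddContactSymmetry_imp_rungZeroAllTimes`, `oddContactSymmetry_imp_shearAllTimes`), so the crux
still claims the Metropolis odd statistic `→ 0` for every `τ` there; the frame bites only where §3's wild-limit mechanism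
lives (post-shock / post-instability horizons of genuinely unsteady data), which it excludes by fiat.  Why it resists (§9.5):
a kernel `¬S` still needs the LAW of the collision point process of the `N`-sphere flow (two-time, beyond Lanford windows);
the physics kill would be an `O(1)` J-odd incoming contact correlation surviving `Kn → 0` before the shock — no mechanism is
known (Chapman–Enskog's odd part is `O(Kn)`, rings `O(φ·Kn)`, both measured decaying, EDMD j013997).  NEXT (re-arm): the MD
falsifier on SHEAR data with the Metropolis weight and `Ψ⋆` (§8.3), equilibrium null at equal `(N,r,ϑ)` subtracted, is now
aimed at a frame-free member of the crux (`OddStatShearAllTimes`); and the lead's stubs once a line is picked.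

RETIRED-FILING VERDICT (rev 1–4, kept as history; its Lean is still valid weight algebra): **no LANDED kill — but the crux AS TYPED is false at rung 0 (§7): the untruncated Gaussian-KDE weight
`1 + e^{−F}` blows up on the deepest velocity-tail collisions for every `ϑ < 0.12√θ`; a `refuted-misstated` finding that
cannot be landed without the collision statistics of the N-sphere flow, so it is filed as analysis + numerics + typed
repair C″/C‴ (§7) + a `stub-misstated` note on the lead's S1.**  Eight lead seats concur (PICKED.md); the route is still
rev 1.  Cycle 2 (§8): the obstruction to a kernel `¬S` is pinned down (blow-up collisions are `N^{−a} ln N` per mean free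
time, so neither a fixed-time nor a perturbative-window witness exists; a kernel `¬S` = a two-time HoleOccurrence law + the
very in-cloud KDE-floor lemma S1′ that would PROVE the repair C′₁); the repairs in circulation are audited with two landed
Negative files (`ParityExactWeights`, `VelocityHoleInBall`): the sub-unit parity-exact weights (C′₃ Metropolis = the maximal
one, Barker, C″ cutoffs) survive every cheap attack and need no hole statement, C′₁ is true-but-expensive (not
configuration-wise bounded: depleted-ball witness) — re-file as C′₃ (or C″) ∧ §5; and the sign-clean admissible witness mark
`psiStar` is checked (continuous, bounded, J-odd for every profile, exchange-even).  Modulo that repair the statement survives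
every cheap attack; this file records, as checked Lean, WHY it resists and WHERE it could still fail.

## Landed (importable, sorry-free) — import these modules, not this work file
* rev 5, seat `refuter-cdisprove-stmt-AtomisticToContinuum-17722-0`, 2026-08-17 (`--supports stmt-AtomisticToContinuum-17722`;
  all ACCEPTED; namespace `Summit.AtomisticToContinuum.HydrodynamicLimit.Theorems.OddContactSymmetryNegative`):
  `…/Theorems/OddContactSymmetry/Negative/MetropolisMixture.lean` (p134531, commit 08006c1b2923: `metropolis_residual_ne_zero_of_mixture`,
  `not_metropolisBalance_for_mixtures`, §9.3); `…/Negative/RungZeroFrame.lean` (p134598, 785ad7f94053: `OddStatRungZeroAllTimes`,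
  `oddContactSymmetry_imp_rungZeroAllTimes`, `not_oddContactSymmetry_of_not_rungZeroAllTimes`, §9.2); `…/Negative/ShearFrame.lean`
  (p134704, fcdb09e97144: `OddStatShearAllTimes`, `oddContactSymmetry_imp_shearAllTimes`, `not_oddContactSymmetry_of_not_shearAllTimes`,
  §9.2); `…/Negative/RevFiveFrame.lean` (p134611, cba7f2f254e7, instance B: `OddStatTail`, `OddContactSymmetryPinned`,
  `oddContactSymmetry_iff_pinned`, `OddContactSymmetrySmoothKinematics`, `oddContactSymmetry_iff_smoothKinematics`, §10); proof
  repair of `…/Negative/RefutationNeedsFlows.lean` (p134458, 13d2f9fa645b: the rev-5 binders broke its `intro`; statement unchanged).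
* rev 1–4 seats (`--supports stmt-AtomisticToContinuum-13078`):
* `Summits/AtomisticToContinuum/HydrodynamicLimit/Theorems/OddContactSymmetry/Negative/RefutationNeedsFlows.lean` (p74169,
  commit cea183a7f2a3): `…Theorems.OddContactSymmetryNegative.not_oddContactSymmetry_requires_flows` (§1).
* `Summits/AtomisticToContinuum/HydrodynamicLimit/Theorems/OddContactSymmetry/Negative/MixtureObstruction.lean` (p74176):
  `…Theorems.OddContactSymmetryNegative.{odd_sum_vanishes_iff_even, reweighted_odd_residual(_eq_zero_iff),
  twoGaussian_mixture_strict, localMaxwellian_one_zero, mixture_mollifier_breaks_twisted_balance, mixture_witness_geometry,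
  not_twistedBalance_for_mixtures, anisotropic_mollifier_breaks_twisted_balance, twisted_balance_of_logQuadratic,
  J_involutive, J_preserves_approach, J_comm_exchange}` (§2–§4, §6).  Import these modules rather than this work file.
* `…/Negative/TailBlowupAndCutoff.lean` (p82777): `tail_blowup_exponent_pos`, `truncation_breaks_parity`,
  `cutoff_reweighted_odd_residual`, `cutoff_weight_bounded` (§7).  Other seats: `…/Negative/VelocityHoleWeight.lean` (lead-0,
  p75620: `hMoll_le_of_isolated`, `exp_neg_surprisal_ge(_rhoMoll)`, `shell_support_confines_queries`),
  `…/Negative/TruncationResidual.lean` (drefute: `truncResidual_*`, `not_truncation_parity_exact`).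
* gen 2 (§8): `…/Negative/ParityExactWeights.lean` (p107061, commit a731a7ac7069): `parityExact_iff`, `parityExact_iff_even`,
  `parityExact_residual(_eq_zero_iff)`, `parityExact_one_add`, `parityExact_min`, `parityExact_barker`, `parityExact_mul_symm`,
  `metropolis_residual`, `barker_residual`, `not_parityExact_trunc`, `le_min_of_parityExact_le_one`,
  `not_unique_subunit_parityExact`; `…/Negative/VelocityHoleInBall.lean` (p107346, commit 37e31dcc4cfb):
  `coneKernel_eq_zero_of_le_dist`, `hMoll_le_of_isolated_inBall`, `exp_neg_surprisal_ge_rhoMoll_inBall`, `rhoMoll_le_of_depleted`,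
  `depletedBall_weight_ge`.  Import those modules (not this work file) to use them.

## Findings (index)

* §10 (rev 5, instance B of this seat, same day) — structural audit of the three insertions: the tie is DATA PINNING and
  nothing else (`oddContactSymmetry_iff_pinned`: below the statics threshold the crux is equivalent to its particle-free form
  with `ρ 0 = rhoLim (profileOf a₀) σ ∧ u 0 = u₀ ∧ θ 0 = θ₀`), continuity-only `u₀, θ₀` are DECORATION
  (`oddContactSymmetry_iff_smoothKinematics`: pinned slices of smooth fields are smooth, so non-smooth profiles make the
  hypotheses contradictory); cheap attacks re-run on the rev-5 text; degraded-search literature note.  (Placed before §9 in the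
  file: B published first, A appended §9 after the merge.)
* §9 (rev 5, item 17722, cycle 1, instance A — TOP) — §9.1 read-back of the four edits of the restatement (frame + Metropolis weight;
  orientation of `e^{−F}`; what `min` clips and what it keeps); §9.2 THE FRAME IS VOID at rung 0 and along the stationary
  shear (`OddStatRungZeroAllTimes`, `OddStatShearAllTimes`, `oddContactSymmetry_imp_rungZeroAllTimes/shearAllTimes`,
  sandwich `OddContactSymmetryMinAllTimes → OddContactSymmetry → rung 0 ∧ shear`, all checked here and landed under
  `Negative/`); §9.3 the Metropolis weight KEEPS the mixture obstruction (`metropolis_residual_ne_zero_of_mixture`,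
  `not_metropolisBalance_for_mixtures`: `r₀` must depend on `η`); §9.4 finite-`N` anatomy of the Metropolis statistic at
  rung 0 (`spiked_metropolis_weight_eq_one`: self-spikes never lower the weight at balance — the O(0.01–0.15) equilibrium
  biases of j013997 are KDE-fluctuation level `(n_b ϑ³)^{−1/2}`, vanishing at fixed `(r,ϑ)`); §9.5 why it resists, what a
  kernel `¬S` owes after rev 5, and the re-arm plan.
* §8 (cycle 2, gen 2) — §8.1 anatomy of a kernel `¬S` (level-`a` bookkeeping `e(a) = −1 − 2a + a²θ/(4(1+a)ϑ²)`, threshold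
  `a*(ϑ) ≈ 2ϑ/√θ`: `N^{1/3−a}` blow-up collisions over `[0,τ]` but `N^{−a} ln N` per mean free time; kernel `¬S` =
  HoleOccurrence (two-time) + S1′ (first-moment, = C′₁'s own transfer debt) + static caps); §8.2 audit of the repairs (landed
  `ParityExactWeights`, `VelocityHoleInBall`; C′₃/C″ survive attacks (1)–(4); C′₁ not configuration-bounded; recommendation
  C′₃ ∧ §5); §8.3 the sign-clean admissible witness mark `psiStar` (`psiStar_continuous/bounded/J_odd/exchange_even/eq_one_of`,
  `stdProfile_props`, `exists_signClean_admissible_mark`).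
* §7 (TOP) velocity-tail blow-up of the untruncated reweighting — `tail_blowup_exponent_pos`, `truncation_breaks_parity`,
  `cutoff_reweighted_odd_residual`, `cutoff_weight_bounded`, typed repairs `OddContactSymmetryCutoff` (C″),
  `OddContactSymmetryRepaired` (C‴ = C′ ∧ C″), `oddContactSymmetryCutoff_imp_repaired`.  Mechanism and numbers in the §7
  module docstring: `(N+1)^{4/3}` collisions probe pre-speeds `s² ≈ (8/3)θ log N`, an `r`-ball's `≍ N` velocities only
  `v_max² ≈ 2θ log N`; the pre-velocity of the deepest collisions is `d ≈ 0.2187√(θ log N)` beyond every sample, so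
  `hm(v⁻) ∼ e^{−d²/2ϑ²}/N` and one collision contributes `T ≍ N^{0.0239 θ/ϑ² − 5/3} → ∞` for `ϑ < 0.1198√θ`, with a mark
  `≈ +1` there ⇒ `P(|D| > η) → 1`.  Smoke numerics (kit j008036): raw `D/K_N[1] ∼ 10^{21…51}`, `max|F| ≤ 85`.

* §1 `not_oddContactSymmetry_requires_flows` / `oddContactSymmetry_of_isEmpty_flows` — the crux quantifies
  `∀ Φ : (N : ℕ) → HardSphereFlow …`, a hypothesis structure pinned down Liouville-a.e. (`good` conull, trajectories on
  `good`, `localGibbsLaw ≪ liouville`).  No junk-flow attack exists, and ANY refutation `¬ OddContactSymmetry` must itself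
  provide a hard-sphere flow for every particle number at some arbitrarily small reduced density and exhibit a local Gibbs
  law charging the bad event.  CORRECTION (cycle 1, later): Alexander's theorem IS proved in tree
  (`Literature.Analysis.FluidPDE.HardSphereFlow.nonempty_torus_holds`, sorry-free), so the flow is available; what a Lean
  refutation still lacks is the QUANTITATIVE law of the collision process along it (§7).  Dually the crux is vacuously TRUE
  wherever the flow type is empty.  No `decide`/small-model refutation is possible.
* §2 `odd_sum_vanishes_iff_even` (finite skeleton of ParitySplit) and `reweighted_odd_residual(_eq_zero_iff)` — what
  J-oddness of `Ψ` buys and what it does not: against ALL odd marks a weight `m` is invisible iff `m = m ∘ J`; for the crux's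
  reweighted weight `m = a·(1 + b′/b)` (`a` = incoming contact pair density at `(n̂,v,w)`, `a′` at `J(n̂,v,w)`, `b = h(v)h(w)`,
  `b′ = h(v′)h(w′)`, `h` = the `(r,ϑ)`-MOLLIFIED empirical law) the odd residual is `(ab′ − a′b)(1/b + 1/b′)`, so the limit
  content of the crux is EXACTLY the twisted detailed balance `a b′ = a′ b`, i.e. `a/(hh_*)` is `J`-invariant — NOT `γ_a = 0`
  alone: it couples the true pair law to the MOLLIFIED one-body law.
* §2b `mixture_of_balanced_is_balanced` — mixtures of `J`-even pair laws are `J`-even: the UNWEIGHTED odd statistic is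
  immune to sub-`r` structure; the fragility below enters only through the weight `1+e^{−F}` (design remark).
* §3 `twoGaussian_mixture_strict`, `mixture_mollifier_breaks_twisted_balance`, `mixture_witness_geometry` — the r-ball
  MIXTURE obstruction made explicit: if the true local law at the collision point is ONE Maxwellian (so `a = a′`, perfect local
  equilibrium, chaotic J-even pair law) but the mollified `h` is a two-temperature mixture (ball of radius `r` straddling a
  temperature step / any sub-`r` structure), then `b ≠ b′` on an explicit collision (`‖v‖² = 2c, w = 0 ↦ ‖v′‖² = ‖w′‖² = c`,
  realised by `n̂ = −e₀, v = e₀ + e₁, w = 0`), hence `ab′ ≠ a′b` and the reweighted odd statistic has a NON-ZERO limit at that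
  `(r, ϑ)`.  This is harmless for the crux exactly as long as the volume where `h_{r,ϑ}` is a genuine mixture → 0 as `r → 0`
  AFTER `N → ∞` (continuous limit fields: fine; shocks/contacts: O(r), fine) — and LETHAL if the `N → ∞` limit fields carry
  O(1)-volume oscillations below every fixed scale `r` (Young-measure / "wild" or turbulent limits), which the crux does not
  exclude because it quantifies over EVERY horizon `τ > 0` (post-shock, post-instability) and every continuous profile, with
  `N → ∞` taken BEFORE `r → 0`.  Not provable either way today (it is the question whether deterministic hard spheres at
  `Kn → 0` realise measure-valued Euler behaviour); recorded as the one live kill mechanism.  See §5 for the typed repair.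
* §4 `twisted_balance_of_logQuadratic` — tightness in `ϑ`: whenever true law / mollified law is log-quadratic
  (`f = h·exp(α + β|u|² + ⟪γ,u⟫)`, which is EXACTLY the case for a Maxwellian `f` under pure velocity (Gaussian) mollification,
  Gaussian ⋆ Gaussian = Gaussian), twisted balance holds identically by momentum + energy conservation of `reflectVel`.  So the
  velocity scale `ϑ` is never the danger; only the spatial scale `r` (mixtures, §3) and a genuinely J-odd `γ` are.
* §3c `anisotropic_mollifier_breaks_twisted_balance` — the same at FIRST order for anisotropic (Reynolds-stress)
  sub-`r` velocity structure: `h_r` anisotropic Gaussian, collision `n = e₀+e₁, v = 2e₀, w = 0`; the turbulence-kill algebra.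
* §3b `not_twistedBalance_for_mixtures` — the natural strengthening "twisted balance holds for EVERY mollified law" is
  FALSE (θ₁ = 1, θ₂ = 2 and the §3 witness collision): refuted strengthening, sorry-free.
* §6 `J_involutive`, `J_preserves_approach`, `J_comm_exchange` — kinematics of the inverse collision used silently by every
  seat: `J² = id`, `J` preserves the approach speed `⟪n̂, v − w⟫` (so incoming ↦ incoming with the same flux factor, whence
  the collision measure `((w−v)·n̂)₊ dn̂ dv dw` is `J`-invariant), and `J` commutes with particle exchange
  `S(n̂,v,w) = (−n̂,w,v)` (the ordered-pair double sum symmetrises over `S` without touching parity).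
* §5 `OddContactSymmetryBeforeShock` (rev-1 implication retired at rev 5, see §9.2) — the minimal REPAIR C′ the glue actually uses
  (ParityInBand only ever invokes the crux for `τ < T`, `T` the classical hs-Euler existence time, under the `t = 0` LLN):
  the crux restricted to `τ < T` along a classical solution.  `OddContactSymmetry → C′` (checked); C′ evades the §3 mechanism
  (classical fields are continuous at every scale), so IF a wild-limit witness ever kills the crux the verdict would be
  `refuted-misstated`, repaired by C′.  Planner: consider re-filing the crux as C′ now (same strength for the route).

## How a kill would go (informal; the standing adversary's conjecture, NOT claimed)
Data: `a₀ ≡ 1`, `θ₀ ≡ 1`, `u₀` = smooth low-Mach shear layer plus a deterministic smooth perturbation (Kelvin–Helmholtz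
unstable), any small `σ`.  (1) In the Euler scaling `Kn ≍ (N+1)^{-1/3} → 0` the empirical fields are a CONSISTENT
APPROXIMATION of compressible Euler (vanishing-Knudsen analogue of vanishing viscosity).  (2) Feireisl–Hofmanová
(arXiv:1905.02548, Thm: a consistent approximation either converges STRONGLY in the energy norm or its limit is NOT a weak
solution) plus the numerical evidence of Fjordholm–Käppeli–Mishra–Tadmor (Found. Comput. Math. 17 (2017), arXiv:1402.0909:
for KH data approximations develop mesh-scale "wiggles" and converge only as Young measures) make scenario (ii) — an
oscillatory, measure-valued limit on the O(1)-volume mixing layer for horizons `τ` past roll-up — the EXPECTED one.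
(3) In scenario (ii) the `r`-mollified law `h_r` is, on that set and for every fixed `r`, a genuine mixture of Maxwellians
(to leading order an anisotropic Gaussian, Reynolds stresses), although the gas is in perfect local equilibrium at the
kinetic scale.  (4) §3c/§3 + §2: the reweighted odd statistic then converges (N → ∞ at fixed r, ϑ) to a NON-zero value that
does not vanish as `r → 0` ⇒ `¬ OddContactSymmetry`.  Steps (1)–(3) are far beyond reach (no construction of the flow's
long-time statistics exists), so nothing is filed; but the planner should note that the crux AS FILED (every `τ > 0`) bets
on STRONG compactness of hard-sphere Euler limits after shocks/instabilities, which the glue never needs — C′ (§5) does not.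

## Design remark for the planner (where the r-fragility lives)
The UNWEIGHTED odd statistic `K_N[χ g Ψ]` is immune to the §3/§3c mechanism: a mixture (over sub-`r` structure) of
`J`-balanced chaotic Maxwellian pair laws is `J`-balanced (`mixture_of_balanced_is_balanced`, linear), so its limit against
odd `Ψ` vanishes even for Young-measure limits, as long as local equilibrium holds at the KINETIC scale.  The weight
`1 + e^{−F}`, read off the `(r,ϑ)`-mollified empirical law, is the sole carrier of the fixed-`r` fragility — it is there to
make the H-split exact (ParitySplit).  A crux stated as "unweighted J-odd contact statistics vanish" + a separate balance
node carrying the mollifier would localise the risk in the node the glue controls by `τ < T`.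

## Load-bearing hypotheses (prose; no dynamics-free Lean form exists, see §1)
* J-oddness of `Ψ`: dropping it admits `Ψ ≡ 1`, and `K_N[χ g (1+e^{−F})] ≥ K_N[χ g] → πσ³τ∫χ Y ρ²⟨|v−w|⟩ > 0` by any rate floor
  (crux RateFloor, stmt-13080) — "any proof must use oddness" is conditional on collisions happening at all, itself a crux.
* Boundedness of `Ψ`: with unbounded odd marks (`|v|⁴+|w|⁴−|v′|⁴−|w′|⁴`) the statistic needs velocity-tail control
  (KineticEnergyTails-type); not a falsity mechanism, a tightness one.
* Continuity of `Ψ` in `n̂`: irrelevant to truth (only `‖n̂‖ = 1` is sampled); continuity in `(v,w)` is what lets weak limits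
  of contact measures act — dropping it changes nothing a refuter can exploit.
* Cutoff `g` vanishing on `[η₀,∞)`: protects against dense pockets; with `σ < σ₀(profiles)` tiny and `N → ∞` first, reduced
  densities `≥ η₀` are large-deviation events at `t = 0`; dynamically (implosions) they are measure-small in space-time.  Not
  attackable without dynamics.
* `∀ τ > 0` (no shock clock): THE soft spot — see §3/§5.
* Ordered-pair double counting: `(i,j)` and `(j,i)` evaluate `χ, g, h` at `x_i` resp. `x_j` (distance `ε`), so the statistic
  only sees the exchange-symmetrised mark up to `O(ε/r) → 0`; exchange `S(n̂,v,w) = (−n̂,w,v)` commutes with `J`, so no parity is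
  lost or gained — checked on paper, harmless.
* Self-spike of `hm` at the particle's own velocity: relative size `1/((N+1) r³ ϑ³) → 0` at fixed `(r,ϑ)`; harmless (also
  guarantees `hm > 0`, so `F` is finite: no `log 0` junk).

## Targets (lead's stuck stubs)
Rev 5 (item 17722): none handed over yet (`payload.targets = []`, `stuck_stubs = []`, `Lines/` empty — crux-ideate round 1
of the restated item is running: cards gaussian-branch-window-transfer, kinetic-slab-entropy-spending, prompt-cluster-locality).
When a line is picked its stubs become `-- Targets` here; the two frame-free members of §9.2 are the natural first checks of
any skeleton's transfer stub (a stub that needs `τ < T` at rung 0 or along the shear is suspicious: the crux does not).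
History (13078): all three round-1 lines died at their transfer stubs on the §7 blow-up of the retired weight.

## Compute
Retired weight: EDMD matrix j013997 (σ = 0.5, τ = 0.25, N+1 ∈ {1000, 2744, 8000, 21952}, equilibrium / travelling wave /
shear; unweighted odd statistic ≤ 5·10⁻⁴ at equilibrium, 0.15–0.2·Kn off equilibrium, decaying, no plateau; bounded
reweightings carry O(0.01–0.15) equilibrium KDE bias at N ≤ 2.2·10⁴), scaling run j014000 (timed out at 6 h), model-exact
pure-python check `EDMDExactStat.md` (13078-1).  REV 5 JOB (submitted 2026-08-17 by instance A, kit **j021368**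
`oddcontact-rev5-matrix`, 16 cores, `--workitem stmt-AtomisticToContinuum-17722` so its summary + manifest attach to the item; smoke
j021348; source `edmd/edmd_rev5.py` + `edmd/main.py` in the seat folder, attached as evidence): event-driven hard spheres on `𝕋³`, the
statistic EXACTLY as restated (cone `bx`, `r = 0.2`; Gaussian KDE `ϑ ∈ {0.3, 0.5}` over ALL particles with CURRENT velocities; `F` as typed;
weight `min 1 (e^{−F})`; both ordered pairs; `ε/(N+1)`), marks `Ψ⋆` (§8.3), `Ψ₂`, `Ψ_S = tanh(S_pre − S_post)`, `S = v_x v_y + w_x w_y`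
(J-odd, exchange-even, Galilean-invariant; couples at first order in `Kn` to the Chapman–Enskog shear distortion), weights `χ ∈ {1, cos 2πx₁}`,
on (a) equilibrium and (b) the SHEAR profiles of `OddStatShearAllTimes` (`u₀ = sin(2π x₁) e₀`) at equal `(N, r, ϑ)`, `σ = 0.5`, `τ = 0.25`,
N+1 ∈ {1000×8, 2744×6, 8000×4, 21952×3, 64000×2 seeds}; output `outputs/table.md`: `(D_shear − D_eq)/K_N[1]/Kn` per mark — a CONSTANT
column is the thesis' `O(Kn)` decay, GROWTH `∝ 1/Kn` is a plateau, i.e. evidence against `OddStatShearAllTimes` and hence the crux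
(`not_oddContactSymmetry_of_not_shearAllTimes`).  Numbers to be entered here on delivery.
-/

namespace Summit.AtomisticToContinuum.HydrodynamicLimit.Cruxes.OddContactSymmetry.Disproof

open Summit.AtomisticToContinuum.HydrodynamicLimit.Theses.JParityClosure
open Literature.Analysis.FluidPDE Literature.MathematicalPhysics.KineticTheory
open scoped InnerProductSpace BigOperators
open MeasureTheory

noncomputable section

/-! ## §1  No refutation without Alexander's theorem; vacuous truth on empty flow types (re-threaded for rev 5) -/

/-- **Any disproof constructs the hard-sphere flow.**  If `OddContactSymmetry` fails then, for every threshold `η₀ > 0`,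
there are admissible profiles such that below EVERY `σ₀` some reduced density `σ` carries an inhabitant of the full family
type `(N : ℕ) → HardSphereFlow 𝕋³ (hsDiameter σ N) (N+1)` — i.e. a refuter must prove Alexander's theorem (for all particle
numbers, at that `σ`) on the way.  Pure logic: the flows are universally quantified in the crux. [folklore] -/
theorem not_oddContactSymmetry_requires_flows (h : ¬ OddContactSymmetry) {η₀ : ℝ} (hη₀ : 0 < η₀) :
    ∃ (a₀ θ₀ : T3 → ℝ) (u₀ : T3 → V3), Continuous a₀ ∧ Continuous θ₀ ∧ Continuous u₀ ∧
      (∀ x, 0 < a₀ x) ∧ (∀ x, 0 < θ₀ x) ∧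
      ∀ σ₀ : ℝ, 0 < σ₀ → ∃ σ : ℝ, 0 < σ ∧ σ < σ₀ ∧
        Nonempty ((N : ℕ) → HardSphereFlow (Torus.geometry (Fin 3)) (hsDiameter σ N) (N + 1)) := by
  classical
  by_contra hne
  push Not at hne
  apply h
  refine ⟨η₀, hη₀, ?_⟩
  intro a₀ θ₀ u₀ ha hθ hu hpa hpθ
  obtain ⟨σ₀, hσ₀, hempty⟩ := hne a₀ θ₀ u₀ ha hθ hu hpa hpθ
  refine ⟨σ₀, hσ₀, ?_⟩
  intro σ hσ hσσ T ρ θ u _ Φ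
  exact ((hempty σ hσ hσσ).false Φ).elim

/-- **Dual vacuity.**  If for all profiles the flow-family type is empty throughout some band `(0, σ₀)`, the crux holds
trivially (with `η₀ := 1`).  The hypothesis is false in reality (Alexander 1975; tree fact `HardSphereFlow.nonempty_torus`),
which is the point: the crux's entire content is conditional on the flows existing, and nothing can be attacked below that.
[folklore] -/
theorem oddContactSymmetry_of_isEmpty_flows
    (h : ∀ (a₀ θ₀ : T3 → ℝ) (u₀ : T3 → V3), ∃ σ₀ : ℝ, 0 < σ₀ ∧ ∀ σ : ℝ, 0 < σ → σ < σ₀ →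
      IsEmpty ((N : ℕ) → HardSphereFlow (Torus.geometry (Fin 3)) (hsDiameter σ N) (N + 1))) :
    OddContactSymmetry := by
  refine ⟨1, one_pos, ?_⟩
  intro a₀ θ₀ u₀ _ _ _ _ _
  obtain ⟨σ₀, hσ₀, hempty⟩ := h a₀ θ₀ u₀
  exact ⟨σ₀, hσ₀, fun σ hσ hσσ T ρ θ u _ Φ => ((hempty σ hσ hσσ).false Φ).elim⟩

/-! ## §2  What oddness buys: the parity lemma and the twisted-detailed-balance residual -/

/-- **Finite skeleton of ParitySplit.**  On a finite index set with an involution `J`, a weight `m` is orthogonal to EVERY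
`J`-odd test function iff `m` is `J`-even.  (The crux tests the reweighted incoming contact measure against every J-odd
bounded continuous mark; its limit content is therefore "reweighted contact weight is J-even", neither more nor less.)
[folklore] -/
theorem odd_sum_vanishes_iff_even {Q : Type*} [Fintype Q] (J : Q → Q) (hJ : Function.Involutive J)
    (m : Q → ℝ) :
    (∀ Ψ : Q → ℝ, (∀ q, Ψ (J q) = -Ψ q) → ∑ q, Ψ q * m q = 0) ↔ ∀ q, m (J q) = m q := by
  constructor
  · intro H q
    have h1 : ∑ q, (m q - m (J q)) * m q = 0 :=
      H (fun q => m q - m (J q)) (by intro q; simp only [hJ q]; ring)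
    have h2 : ∑ q, (m q - m (J q)) * m (J q) = -∑ q, (m q - m (J q)) * m q := by
      rw [← Finset.sum_neg_distrib]
      refine Fintype.sum_equiv (hJ.toPerm J) _ _ (fun q => ?_)
      simp only [Function.Involutive.coe_toPerm, hJ q]
      ring
    have h3 : ∑ q, (m q - m (J q)) ^ 2 = 0 := by
      have : ∑ q, (m q - m (J q)) ^ 2 =
          ∑ q, (m q - m (J q)) * m q - ∑ q, (m q - m (J q)) * m (J q) := by
        rw [← Finset.sum_sub_distrib]
        refine Finset.sum_congr rfl (fun q _ => ?_)
        ring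
      rw [this, h2, h1]
      ring
    have h4 : (m q - m (J q)) ^ 2 = 0 :=
      (Finset.sum_eq_zero_iff_of_nonneg (fun q _ => sq_nonneg (m q - m (J q)))).1 h3 q (Finset.mem_univ q)
    have h5 : m q - m (J q) = 0 := pow_eq_zero_iff (two_ne_zero) |>.1 h4
    linarith
  · intro hm Ψ hΨ
    have : ∑ q, Ψ q * m q = -∑ q, Ψ q * m q := by
      rw [← Finset.sum_neg_distrib]
      refine Fintype.sum_equiv (hJ.toPerm J) _ _ (fun q => ?_)
      simp only [Function.Involutive.coe_toPerm, hΨ q, hm q]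
      ring
    linarith

/-- **The reweighted odd residual.**  Dictionary: `a` = incoming contact pair density at `q = (n̂,v,w)`, `a'` = at `J q`,
`b = h(v)h(w)`, `b' = h(v′)h(w′)` with `h` the `(r,ϑ)`-mollified one-body law read at the collision point, so that the crux's
weight `1 + e^{−F}` is `1 + b'/b` at `q` and `1 + b/b'` at `J q`.  The `J`-odd part of the reweighted weight is
`(a b' − a' b)(1/b + 1/b')`. [folklore] -/
theorem reweighted_odd_residual (a a' b b' : ℝ) (hb : b ≠ 0) (hb' : b' ≠ 0) :
    a * (1 + b' / b) - a' * (1 + b / b') = (a * b' - a' * b) * (1 / b + 1 / b') := by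
  field_simp
  ring

/-- **Twisted detailed balance is the exact limit content.**  With positive mollified weights, the reweighted weight is
`J`-even at `q` iff `a b' = a' b`, i.e. iff `a/(h h_*)` is `J`-invariant: the crux couples the TRUE incoming pair law to the
MOLLIFIED one-body law; it is not the bare statement `γ_a = 0` unless `h` is the true local law up to a log-collision-invariant
factor (§4). [folklore] -/
theorem reweighted_odd_residual_eq_zero_iff (a a' b b' : ℝ) (hb : 0 < b) (hb' : 0 < b') :
    a * (1 + b' / b) - a' * (1 + b / b') = 0 ↔ a * b' = a' * b := by
  rw [reweighted_odd_residual a a' b b' hb.ne' hb'.ne', mul_eq_zero, sub_eq_zero]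
  have hpos : 0 < 1 / b + 1 / b' := by positivity
  constructor
  · rintro (h | h)
    · exact h
    · exact absurd h hpos.ne'
  · exact fun h => Or.inl h

/-- **Mixtures of balanced pair laws are balanced** (linear): if every component `a k` is `J`-even then so is any
finite combination.  With chaotic Maxwellian components (`M_λ(v)M_λ(w) = M_λ(v′)M_λ(w′)`, energy conservation) this is why
the UNWEIGHTED odd statistic survives sub-`r` structure while the reweighted one (§3) does not. [folklore] -/
theorem mixture_of_balanced_is_balanced {Q ι : Type*} (J : Q → Q) (s : Finset ι) (c : ι → ℝ) (a : ι → Q → ℝ)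
    (h : ∀ k ∈ s, ∀ q, a k (J q) = a k q) (q : Q) :
    (∑ k ∈ s, c k * a k (J q)) = ∑ k ∈ s, c k * a k q :=
  Finset.sum_congr rfl fun k hk => by rw [h k hk q]

/-! ## §3  The r-ball mixture obstruction (explicit two-temperature witness) -/

/-- **Two-Gaussian mixtures are strictly log-convex in the energy.**  For positive amplitudes and two DIFFERENT temperatures,
`h(E) = C₁ e^{−E/2θ₁} + C₂ e^{−E/2θ₂}` satisfies `h(c)² < h(2c)·h(0)` for `c ≠ 0`
(`h(2c)h(0) − h(c)² = C₁C₂ (e^{−c/2θ₁} − e^{−c/2θ₂})²`).  A single Maxwellian gives equality (energy conservation); the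
mixture does not. [folklore] -/
theorem twoGaussian_mixture_strict {C₁ C₂ θ₁ θ₂ c : ℝ} (hC₁ : 0 < C₁) (hC₂ : 0 < C₂)
    (h₁ : 0 < θ₁) (h₂ : 0 < θ₂) (hne : θ₁ ≠ θ₂) (hc : c ≠ 0) :
    (C₁ * Real.exp (-c / (2 * θ₁)) + C₂ * Real.exp (-c / (2 * θ₂))) *
        (C₁ * Real.exp (-c / (2 * θ₁)) + C₂ * Real.exp (-c / (2 * θ₂))) <
      (C₁ * Real.exp (-(2 * c) / (2 * θ₁)) + C₂ * Real.exp (-(2 * c) / (2 * θ₂))) *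
        (C₁ * Real.exp (-0 / (2 * θ₁)) + C₂ * Real.exp (-0 / (2 * θ₂))) := by
  set x := Real.exp (-c / (2 * θ₁)) with hxdef
  set y := Real.exp (-c / (2 * θ₂)) with hydef
  have hx : Real.exp (-(2 * c) / (2 * θ₁)) = x ^ 2 := by
    rw [hxdef, sq, ← Real.exp_add]; congr 1; ring
  have hy : Real.exp (-(2 * c) / (2 * θ₂)) = y ^ 2 := by
    rw [hydef, sq, ← Real.exp_add]; congr 1; ring
  have hxy : x ≠ y := by
    intro heq
    have h' : -c / (2 * θ₁) = -c / (2 * θ₂) := Real.exp_injective heq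
    rw [div_eq_div_iff (by positivity) (by positivity)] at h'
    have h'' : c * (θ₁ - θ₂) = 0 := by linarith
    rcases mul_eq_zero.1 h'' with h0 | h0
    · exact hc h0
    · exact hne (sub_eq_zero.1 h0)
  have h0 : Real.exp (-0 / (2 * θ₁)) = 1 := by rw [neg_zero, zero_div, Real.exp_zero]
  have h0' : Real.exp (-0 / (2 * θ₂)) = 1 := by rw [neg_zero, zero_div, Real.exp_zero]
  rw [hx, hy, h0, h0']
  have key : (C₁ * x ^ 2 + C₂ * y ^ 2) * (C₁ * 1 + C₂ * 1) - (C₁ * x + C₂ * y) * (C₁ * x + C₂ * y) =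
      C₁ * C₂ * (x - y) ^ 2 := by ring
  have hpos : 0 < C₁ * C₂ * (x - y) ^ 2 := by
    have := sq_pos_of_ne_zero (sub_ne_zero.2 hxy)
    positivity
  linarith

/-- Unfolding of the centred unit-density Maxwellian used by the crux's velocity mollifier
(`hm = ∫ bx · localMaxwellian 1 (ϑ²) v (·)`). [folklore] -/
theorem localMaxwellian_one_zero (θ : ℝ) (u : V3) :
    localMaxwellian 1 θ (0 : V3) u =
      (2 * Real.pi * θ) ^ (-(Module.finrank ℝ V3 : ℝ) / 2) * Real.exp (-‖u‖ ^ 2 / (2 * θ)) := by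
  simp only [localMaxwellian, sub_zero, one_mul]

/-- **The mixture mollifier breaks twisted balance on an explicit collision.**  Let the mollified law at the collision
point be the equal-weight two-temperature mixture `hmix = M_{θ₁} + M_{θ₂}` (a ball of radius `r` straddling a temperature
step, or any sub-`r` thermal structure), `θ₁ ≠ θ₂`.  On any collision with pre-energies `(2c, 0)` and post-energies `(c, c)`
one has `hmix(v′)hmix(w′) < hmix(v)hmix(w)`, i.e. `b' < b` in the dictionary of `reweighted_odd_residual`; if the TRUE local
pair law is chaotic-Maxwellian at ONE temperature (`a = a'`, perfect local equilibrium, `γ` J-even) the odd residual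
`a(b' − b)(1/b + 1/b') ≠ 0`: the reweighted odd statistic converges to a NON-ZERO value at that fixed `(r,ϑ)` although nothing
is out of local equilibrium.  Harmless iff the mixture volume → 0 as `r → 0` after `N → ∞`. [folklore] -/
theorem mixture_mollifier_breaks_twisted_balance {θ₁ θ₂ c : ℝ} (h₁ : 0 < θ₁) (h₂ : 0 < θ₂) (hne : θ₁ ≠ θ₂)
    (hc : c ≠ 0) (v w v' w' : V3)
    (hv : ‖v‖ ^ 2 = 2 * c) (hw : ‖w‖ ^ 2 = 0) (hv' : ‖v'‖ ^ 2 = c) (hw' : ‖w'‖ ^ 2 = c) :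
    (localMaxwellian 1 θ₁ (0 : V3) v' + localMaxwellian 1 θ₂ (0 : V3) v') *
        (localMaxwellian 1 θ₁ (0 : V3) w' + localMaxwellian 1 θ₂ (0 : V3) w') <
      (localMaxwellian 1 θ₁ (0 : V3) v + localMaxwellian 1 θ₂ (0 : V3) v) *
        (localMaxwellian 1 θ₁ (0 : V3) w + localMaxwellian 1 θ₂ (0 : V3) w) := by
  have hC₁ : 0 < (2 * Real.pi * θ₁) ^ (-(Module.finrank ℝ V3 : ℝ) / 2) :=
    Real.rpow_pos_of_pos (by positivity) _
  have hC₂ : 0 < (2 * Real.pi * θ₂) ^ (-(Module.finrank ℝ V3 : ℝ) / 2) :=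
    Real.rpow_pos_of_pos (by positivity) _
  have key := twoGaussian_mixture_strict hC₁ hC₂ h₁ h₂ hne hc
  simp only [localMaxwellian_one_zero, hv, hw, hv', hw']
  convert key using 2

/-- **Geometric realisation of the witness collision** (`c = 1`): impact direction `n̂ = −e₀` (unit, INCOMING for the pair
below: `⟪n̂, v − w⟫ = −1 < 0`), pre-velocities `v = e₀ + e₁`, `w = 0`; the crux's `reflectVel` gives post-velocities
`(e₁, e₀)`, so the energies go `(2, 0) ↦ (1, 1)` — exactly the hypotheses of `mixture_mollifier_breaks_twisted_balance`.
[folklore] -/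
theorem mixture_witness_geometry :
    let e₀ : V3 := EuclideanSpace.single (0 : Fin 3) (1 : ℝ)
    let e₁ : V3 := EuclideanSpace.single (1 : Fin 3) (1 : ℝ)
    ‖(-e₀ : V3)‖ = 1 ∧ ⟪(-e₀ : V3), (e₀ + e₁) - 0⟫_ℝ < 0 ∧
      reflectVel (-e₀) (e₀ + e₁, (0 : V3)) = (e₁, e₀) ∧
      ‖e₀ + e₁‖ ^ 2 = 2 * 1 ∧ ‖(0 : V3)‖ ^ 2 = 0 ∧ ‖e₁‖ ^ 2 = 1 ∧ ‖e₀‖ ^ 2 = 1 := by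
  intro e₀ e₁
  have n0 : ‖e₀‖ = 1 := by simp [e₀]
  have n1 : ‖e₁‖ = 1 := by simp [e₁]
  have i00 : ⟪e₀, e₀⟫_ℝ = 1 := by simp [e₀]
  have i11 : ⟪e₁, e₁⟫_ℝ = 1 := by simp [e₁]
  have i01 : ⟪e₀, e₁⟫_ℝ = 0 := by
    simp only [e₀, e₁, EuclideanSpace.inner_single_left, PiLp.single_apply]
    norm_num
  have i10 : ⟪e₁, e₀⟫_ℝ = 0 := by
    simp only [e₀, e₁, EuclideanSpace.inner_single_left, PiLp.single_apply]
    norm_num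
  have hsum : ‖e₀ + e₁‖ ^ 2 = 2 := by
    rw [← real_inner_self_eq_norm_sq, inner_add_left, inner_add_right, inner_add_right, i00, i01, i10, i11]
    norm_num
  refine ⟨by rw [norm_neg, n0], ?_, ?_, by rw [hsum]; norm_num, by simp, by rw [n1]; norm_num, by rw [n0]; norm_num⟩
  · rw [sub_zero, inner_neg_left, inner_add_right, i00, i01]
    norm_num
  · have hcoef : ⟪(e₀ + e₁) - 0, -e₀⟫_ℝ / ‖(-e₀ : V3)‖ ^ 2 = -1 := by
      rw [sub_zero, inner_neg_right, inner_add_left, i00, i10, norm_neg, n0]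
      norm_num
    simp only [reflectVel, hcoef, Prod.mk.injEq]
    constructor
    · simp only [neg_one_smul, neg_neg]
      abel
    · simp only [neg_one_smul, neg_neg, zero_add]


/-- **Refuted strengthening (§3b).**  "Twisted balance `h(v)h(w) = h(v′)h(w′)` holds on every collision for every
two-temperature mollified law" is false: `θ₁ = 1, θ₂ = 2`, `n = −e₀`, `v = e₀ + e₁`, `w = 0`.  Hence "the reweighted odd
statistic vanishes at FIXED `(r,ϑ)` for all data" — the `r₀`-free strengthening of the crux's limit content — fails
already against perfectly chaotic Maxwellian pair laws; only the `r → 0` passage can save the crux. [folklore] -/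
theorem not_twistedBalance_for_mixtures :
    ¬ (∀ θ₁ θ₂ : ℝ, 0 < θ₁ → 0 < θ₂ → ∀ n v w : V3,
        (localMaxwellian 1 θ₁ (0 : V3) v + localMaxwellian 1 θ₂ (0 : V3) v) *
            (localMaxwellian 1 θ₁ (0 : V3) w + localMaxwellian 1 θ₂ (0 : V3) w) =
          (localMaxwellian 1 θ₁ (0 : V3) (reflectVel n (v, w)).1 + localMaxwellian 1 θ₂ (0 : V3) (reflectVel n (v, w)).1) *
            (localMaxwellian 1 θ₁ (0 : V3) (reflectVel n (v, w)).2 +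
              localMaxwellian 1 θ₂ (0 : V3) (reflectVel n (v, w)).2)) := by
  intro H
  obtain ⟨_, _, hrefl, hv, hw, h1, h0⟩ := mixture_witness_geometry
  set e₀ : V3 := EuclideanSpace.single (0 : Fin 3) (1 : ℝ)
  set e₁ : V3 := EuclideanSpace.single (1 : Fin 3) (1 : ℝ)
  have heq := H 1 2 one_pos two_pos (-e₀) (e₀ + e₁) 0
  rw [hrefl] at heq
  have hlt := mixture_mollifier_breaks_twisted_balance (θ₁ := 1) (θ₂ := 2) one_pos two_pos (by norm_num)
    (c := 1) one_ne_zero (e₀ + e₁) 0 e₁ e₀ hv hw h1 h0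
  linarith


/-- **Anisotropic sub-`r` velocity structure breaks twisted balance at FIRST order (§3c).**  If the ball of radius
`r` carries velocity fluctuations with an ANISOTROPIC covariance (the leading effect of any sub-`r` shear/vortical
structure — Reynolds stresses of a turbulent or rolled-up layer — on the mollified law), `h_r` is to leading order an
anisotropic Gaussian `h(u) = exp(−u₀²/2θ₁ − (u₁²+u₂²)/2θ₂)`, `θ₁ ≠ θ₂`.  On the collision `n = e₀ + e₁` (unnormalised;
`reflectVel` normalises), `v = 2e₀`, `w = 0` (incoming for the reversed normal, approach speed `2`), the post-velocities are
`(e₀ − e₁, e₀ + e₁)`: x-energy `4 ↦ 2`, y-energy `0 ↦ 2`, so `h(v′)h(w′) ≠ h(v)h(w)` — twisted balance fails at first order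
in `1/θ₁ − 1/θ₂` — while the isotropic Maxwellian pair weight (last conjunct, the TRUE chaotic local pair law) is balanced.
With `reweighted_odd_residual` this is an O(anisotropy) NON-zero limit of the crux statistic at every fixed `r` above the
structure's scale: the algebra of the one live kill mechanism (O(1)-volume sub-`r` structure at some horizon `τ`). [folklore] -/
theorem anisotropic_mollifier_breaks_twisted_balance {θ₁ θ₂ : ℝ} (h₁ : 0 < θ₁) (h₂ : 0 < θ₂) (hne : θ₁ ≠ θ₂) :
    let e₀ : V3 := EuclideanSpace.single (0 : Fin 3) (1 : ℝ)
    let e₁ : V3 := EuclideanSpace.single (1 : Fin 3) (1 : ℝ)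
    let h : V3 → ℝ := fun u => Real.exp (-(u 0) ^ 2 / (2 * θ₁) - ((u 1) ^ 2 + (u 2) ^ 2) / (2 * θ₂))
    reflectVel (e₀ + e₁) ((2 : ℝ) • e₀, (0 : V3)) = (e₀ - e₁, e₀ + e₁) ∧
      ⟪e₀ + e₁, (2 : ℝ) • e₀ - 0⟫_ℝ = 2 ∧
      h (e₀ - e₁) * h (e₀ + e₁) ≠ h ((2 : ℝ) • e₀) * h 0 ∧
      Real.exp (-‖e₀ - e₁‖ ^ 2 / 2) * Real.exp (-‖e₀ + e₁‖ ^ 2 / 2) =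
        Real.exp (-‖(2 : ℝ) • e₀‖ ^ 2 / 2) * Real.exp (-‖(0 : V3)‖ ^ 2 / 2) := by
  intro e₀ e₁ h
  have i00 : ⟪e₀, e₀⟫_ℝ = 1 := by simp [e₀]
  have i11 : ⟪e₁, e₁⟫_ℝ = 1 := by simp [e₁]
  have i01 : ⟪e₀, e₁⟫_ℝ = 0 := by
    simp only [e₀, e₁, EuclideanSpace.inner_single_left, PiLp.single_apply]
    norm_num
  have i10 : ⟪e₁, e₀⟫_ℝ = 0 := by
    simp only [e₀, e₁, EuclideanSpace.inner_single_left, PiLp.single_apply]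
    norm_num
  have hsum : ‖e₀ + e₁‖ ^ 2 = 2 := by
    rw [← real_inner_self_eq_norm_sq, inner_add_left, inner_add_right, inner_add_right, i00, i01, i10, i11]
    norm_num
  have hdiff : ‖e₀ - e₁‖ ^ 2 = 2 := by
    rw [← real_inner_self_eq_norm_sq, inner_sub_left, inner_sub_right, inner_sub_right, i00, i01, i10, i11]
    norm_num
  have n0 : ‖e₀‖ = 1 := by simp [e₀]
  have htwo : ‖(2 : ℝ) • e₀‖ ^ 2 = 4 := by
    rw [norm_smul, Real.norm_eq_abs, n0]; norm_num
  have hin : ⟪(2 : ℝ) • e₀ - 0, e₀ + e₁⟫_ℝ = 2 := by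
    rw [sub_zero, inner_smul_left, inner_add_right, i00, i01]; norm_num
  refine ⟨?_, ?_, ?_, ?_⟩
  · have hcoef : ⟪(2 : ℝ) • e₀ - 0, e₀ + e₁⟫_ℝ / ‖e₀ + e₁‖ ^ 2 = 1 := by
      rw [hin, hsum]; norm_num
    simp only [reflectVel, hcoef, one_smul, zero_add, Prod.mk.injEq, and_true]
    rw [two_smul]
    abel
  · rw [← inner_conj_symm]
    simpa using hin
  · -- coordinates
    have c0 : ∀ j : Fin 3, e₀ j = if j = 0 then 1 else 0 := by intro j; simp [e₀, PiLp.single_apply]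
    have c1 : ∀ j : Fin 3, e₁ j = if j = 1 then 1 else 0 := by intro j; simp [e₁, PiLp.single_apply]
    have d20 : ((2 : Fin 3) = 0) = False := eq_false (by decide)
    have d21 : ((2 : Fin 3) = 1) = False := eq_false (by decide)
    have d10 : ((1 : Fin 3) = 0) = False := eq_false (by decide)
    have d01 : ((0 : Fin 3) = 1) = False := eq_false (by decide)
    have hA : h (e₀ - e₁) = Real.exp (-1 / (2 * θ₁) - 1 / (2 * θ₂)) := by
      simp only [h, PiLp.sub_apply, c0, c1, d20, d21, d10, d01, if_true, if_false]
      congr 1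
      ring
    have hB : h (e₀ + e₁) = Real.exp (-1 / (2 * θ₁) - 1 / (2 * θ₂)) := by
      simp only [h, PiLp.add_apply, c0, c1, d20, d21, d10, d01, if_true, if_false]
      congr 1
      ring
    have hC : h ((2 : ℝ) • e₀) = Real.exp (-4 / (2 * θ₁)) := by
      simp only [h, PiLp.smul_apply, c0, d20, d10, if_true, if_false, smul_eq_mul]
      congr 1
      ring
    have hD : h 0 = 1 := by
      simp [h]
    rw [hA, hB, hC, hD, mul_one, ← Real.exp_add]
    intro heq
    have := Real.exp_injective heq
    field_simp at this
    apply hne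
    nlinarith [this]
  · rw [hdiff, hsum, htwo, norm_zero, ← Real.exp_add, ← Real.exp_add]
    norm_num

/-! ## §4  Tightness in `ϑ`: log-quadratic discrepancies are invisible -/

/-- **Twisted balance holds whenever true/mollified is log-quadratic.**  If `f = h · exp(α + β‖u‖² + ⟪γ,u⟫)` (a
log-collision-invariant factor) then for EVERY impact direction `n` and pre-velocities `(v,w)`, with `(v′,w′) = reflectVel n
(v,w)`: `f(v)f(w)·h(v′)h(w′) = f(v′)f(w′)·h(v)h(w)`, i.e. `a b' = a' b` for `a = f f_*` (chaotic pair law) and `b = h h_*`.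
Momentum and energy conservation of the tree's `reflectVel` are the only inputs.  Since Gaussian ⋆ Gaussian is Gaussian, a
local Maxwellian mollified in velocity only (`ϑ > 0`, `r → 0`) is related to itself by such a factor: the velocity scale `ϑ`
of the crux never produces a spurious odd signal at local equilibrium. [folklore] -/
theorem twisted_balance_of_logQuadratic (f h : V3 → ℝ) (α β : ℝ) (γ : V3)
    (hfh : ∀ u, f u = h u * Real.exp (α + β * ‖u‖ ^ 2 + ⟪γ, u⟫_ℝ)) (n v w : V3) :
    f v * f w * (h (reflectVel n (v, w)).1 * h (reflectVel n (v, w)).2) =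
      f (reflectVel n (v, w)).1 * f (reflectVel n (v, w)).2 * (h v * h w) := by
  have hE : ‖(reflectVel n (v, w)).1‖ ^ 2 + ‖(reflectVel n (v, w)).2‖ ^ 2 = ‖v‖ ^ 2 + ‖w‖ ^ 2 :=
    norm_sq_reflectVel_fst_add_norm_sq_reflectVel_snd n (v, w)
  have hP : (reflectVel n (v, w)).1 + (reflectVel n (v, w)).2 = v + w :=
    reflectVel_fst_add_reflectVel_snd n (v, w)
  have hI : ⟪γ, (reflectVel n (v, w)).1⟫_ℝ + ⟪γ, (reflectVel n (v, w)).2⟫_ℝ = ⟪γ, v⟫_ℝ + ⟪γ, w⟫_ℝ := by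
    rw [← inner_add_right, ← inner_add_right, hP]
  have hexp : Real.exp (α + β * ‖v‖ ^ 2 + ⟪γ, v⟫_ℝ) * Real.exp (α + β * ‖w‖ ^ 2 + ⟪γ, w⟫_ℝ) =
      Real.exp (α + β * ‖(reflectVel n (v, w)).1‖ ^ 2 + ⟪γ, (reflectVel n (v, w)).1⟫_ℝ) *
        Real.exp (α + β * ‖(reflectVel n (v, w)).2‖ ^ 2 + ⟪γ, (reflectVel n (v, w)).2⟫_ℝ) := by
    rw [← Real.exp_add, ← Real.exp_add]
    congr 1
    linear_combination (-β) * hE - hI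
  rw [hfh v, hfh w, hfh (reflectVel n (v, w)).1, hfh (reflectVel n (v, w)).2]
  linear_combination (h v * h w * h (reflectVel n (v, w)).1 * h (reflectVel n (v, w)).2) * hexp

/-! ## §6  Kinematics of the inverse collision `J(n̂,v,w) = (−n̂, v′, w′)` -/

/-- `J` is an involution on the velocity components (and trivially on `n̂`): `reflectVel (−n) ∘ reflectVel n = id`.
[folklore] -/
theorem J_involutive (n : V3) (p : V3 × V3) : reflectVel (-n) (reflectVel n p) = p := by
  rw [reflectVel_neg, reflectVel_reflectVel]

/-- `J` preserves the approach speed: `⟪−n, v′ − w′⟫ = ⟪n, v − w⟫`.  So `J` maps incoming collision parameters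
(`⟪n̂, v − w⟫ < 0`) to incoming ones with the SAME flux factor `((w−v)·n̂)₊`; together with the measure-preserving
`(v,w) ↦ (v′,w′)` and `n̂ ↦ −n̂` this is why the chaotic collision measure `((w−v)·n̂)₊ f(v)f(w) dn̂ dv dw` pairs with
its `J`-image and the H-split is exact. [folklore] -/
theorem J_preserves_approach (n : V3) (p : V3 × V3) :
    ⟪-n, (reflectVel n p).1 - (reflectVel n p).2⟫_ℝ = ⟪n, p.1 - p.2⟫_ℝ := by
  by_cases hn : n = 0
  · subst hn
    simp
  · rw [inner_neg_left, inner_reflectVel_fst_sub_snd n hn p, neg_neg]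

/-- `J` commutes with particle exchange `S(n̂,v,w) = (−n̂,w,v)` on the velocity components:
`reflectVel (−n) (w,v) = ((reflectVel n (v,w)).2, (reflectVel n (v,w)).1)`.  The crux's ordered-pair double sum reads
`χ, g, h` at `x_i` for `(i,j)` and at `x_j` for `(j,i)` (distance `ε`), i.e. it symmetrises the mark over `S` up to
`O(ε/r)`; since `S` and `J` commute, the `S`-symmetrisation of a `J`-odd mark is `J`-odd — no parity is created or lost.
[folklore] -/
theorem J_comm_exchange (n : V3) (p : V3 × V3) :
    reflectVel (-n) (p.2, p.1) = ((reflectVel n p).2, (reflectVel n p).1) := by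
  rw [reflectVel_neg, reflectVel_swap]

/-! ## §5  The typed repair C′ (HISTORY: adopted at rev 5 together with the Metropolis weight, see §9) -/

/-- **C′ = the rev-1 crux restricted to the classical window** (rev-1 weight `1 + e^{−F}` kept).  Verbatim the retired
filing, with three insertions: a
classical hard-sphere Euler solution `(ρ,u,θ)` on `[0,T)` (`IsHardSphereEulerSolution σ T ρ u θ`), the `t = 0` law of large
numbers tying the local Gibbs data to it (`TendstoHydroFieldsAt … 0`, exactly the conjunct's hypothesis), and the horizon
restriction `τ < T`.  This is the only way the glue `ParityInBand` ever uses the crux; it evades the §3 mixture mechanism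
(classical fields are continuous at every scale `r`), whereas the crux as filed also claims all post-shock / post-instability
horizons.  Candidate repaired statement for a `refuted-misstated` verdict, should a wild-limit witness ever be constructed.
[folklore] -/
def OddContactSymmetryBeforeShock : Prop :=
  ∃ η₀ : ℝ, 0 < η₀ ∧ ∀ (a₀ θ₀ : Literature.MathematicalPhysics.KineticTheory.T3 → ℝ) (u₀ : Literature.MathematicalPhysics.KineticTheory.T3 → Literature.MathematicalPhysics.KineticTheory.V3), Continuous a₀ → Continuous θ₀ → Continuous u₀ → (∀ x, 0 < a₀ x) → (∀ x, 0 < θ₀ x) → ∃ σ₀ : ℝ, 0 < σ₀ ∧ ∀ σ : ℝ, 0 < σ → σ < σ₀ → ∀ (T : ℝ) (ρ θ : ℝ → Literature.MathematicalPhysics.KineticTheory.T3 → ℝ) (u : ℝ → Literature.MathematicalPhysics.KineticTheory.T3 → Literature.MathematicalPhysics.KineticTheory.V3), Literature.MathematicalPhysics.KineticTheory.IsHardSphereEulerSolution σ T ρ u θ → ∀ Φ : (N : ℕ) → Literature.Analysis.FluidPDE.HardSphereFlow (Literature.Analysis.FluidPDE.Torus.geometry (Fin 3)) (Literature.MathematicalPhysics.KineticTheory.hsDiameter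 σ N) (N + 1), Literature.MathematicalPhysics.KineticTheory.TendstoHydroFieldsAt (fun N => Literature.MathematicalPhysics.KineticTheory.localGibbsLaw σ a₀ u₀ θ₀ N (Φ N)) Φ ρ u θ 0 → ∀ τ : ℝ, 0 < τ → τ < T → ∀ χ : ℝ × UnitAddTorus (Fin 3) → ℝ, Continuous χ → ∀ g : ℝ → ℝ, Continuous g → (∀ a, η₀ ≤ a → g a = 0) → ∀ Ψ : EuclideanSpace ℝ (Fin 3) × EuclideanSpace ℝ (Fin 3) × EuclideanSpace ℝ (Fin 3) → ℝ, Continuous Ψ → (∃ C : ℝ, ∀ q, |Ψ q| ≤ C) → (∀ (n v w : EuclideanSpace ℝ (Fin 3)), ‖n‖ = 1 → Ψ (-n, (Literature.Analysis.FluidPDE.reflectVel n (v, w)).1, (Literature.Analysis.FluidPDE.reflectVel n (v, w)).2) = -Ψ (n, v, w)) → ∀ η δ : ℝ, 0 < η → 0 < δ → ∃ r₀ : ℝ, 0 < r₀ ∧ ∀ r ϑ : ℝ, 0 < r → r < r₀ → 0 < ϑ → ϑ < r₀ → ∃ N₀ : ℕ, ∀ N : ℕ, N₀ ≤ N → let ε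 := Literature.MathematicalPhysics.KineticTheory.hsDiameter σ N; let G := Literature.Analysis.FluidPDE.Torus.geometry (Fin 3); let γ := fun z (s : ℝ) => (Φ N).flow s z; let bx : UnitAddTorus (Fin 3) → UnitAddTorus (Fin 3) → ℝ := fun x y => 3 / (Real.pi * r ^ 3) * max (1 - Literature.Analysis.FluidPDE.Torus.euclidDist x y / r) 0; let ρm := fun z s (x₀ : UnitAddTorus (Fin 3)) => ∫ q, bx q.1 x₀ ∂(Literature.Analysis.FluidPDE.empiricalMeasure (γ z s)); let hm := fun z s (x₀ : UnitAddTorus (Fin 3)) (v : EuclideanSpace ℝ (Fin 3)) => ∫ q, bx q.1 x₀ * Literature.Analysis.FluidPDE.localMaxwellian 1 (ϑ ^ 2) v q.2 ∂(Literature.Analysis.FluidPDE.empiricalMeasure (γ z s)); let pv := fun z s (i j : Fin (N + 1)) => Literature.Analysis.FluidPDE.reflectVel (G.sepVec (γ z s i).1 (γ z s j).1) ((γ z s i).2, (γ z s j).2); let F := fun z s (i j : Fin (N + 1)) => Real.log (hm z s (γ z s i).1 (pv z s i j).1) + Real.log (hm z s (γ z s i).1 (pv z s i j).2) - Real.log (hm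 z s (γ z s i).1 (γ z s i).2) - Real.log (hm z s (γ z s i).1 (γ z s j).2); let Kc := fun (Fn : Literature.Analysis.FluidPDE.Config (N + 1) (Fin 3) Literature.MathematicalPhysics.KineticTheory.T3 → ℝ → Fin (N + 1) → Fin (N + 1) → ℝ) z => ε / (N + 1 : ℝ) * ∑ᶠ (s : ℝ) (_ : s ∈ Literature.Analysis.FluidPDE.collisionTimes G ε (γ z) ∩ Set.Icc 0 τ), ∑ i : Fin (N + 1), ∑ j : Fin (N + 1), (if i ≠ j ∧ ‖G.sepVec (γ z s i).1 (γ z s j).1‖ = ε then Fn z s i j else 0); let D := fun z => Kc (fun z s i j => χ (s, (γ z s i).1) * g (σ ^ 3 * ρm z s (γ z s i).1) * (Ψ (ε⁻¹ • G.sepVec (γ z s i).1 (γ z s j).1, (pv z s i j).1, (pv z s i j).2) * (1 + Real.exp (-F z s i j)))) z; Literature.MathematicalPhysics.KineticTheory.localGibbsLaw σ a₀ u₀ θ₀ N (Φ N) {z | η < |D z|} ≤ ENNReal.ofReal δ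

/-! (rev 5) The rev-1 implication `OddContactSymmetry → OddContactSymmetryBeforeShock` of cycle 1 is retired with the
rev-1 decl: the restated crux carries the frame itself AND a different weight, so the two are no longer comparable by pure
logic.  Its rev-5 counterpart is `oddContactSymmetryMinAllTimes_imp` (§9.2): the frame-free Metropolis statement implies the
crux. -/

/-! ## §7  (HISTORY, rev 1–4) The untruncated reweighting blows up in the velocity tail (rung 0 included) — the finding
that retired item 13078; at rev 5 the same collisions have `e^{−F} → ∞` clipped at `1` (§9.1), the algebra below stands -/

/-!
### The mechanism (numbers, equilibrium, constant profiles `a₀ ≡ 1, u₀ ≡ 0, θ₀ ≡ θ`; found cycle 1, 2026-08-16)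

`e^{−F} = hm(v⁺)hm(w⁺)/(hm(v⁻)hm(w⁻))`, `hm(x_i,·)` = Gaussian KDE of bandwidth `ϑ` over the `n_b ≈ (N+1)·(4π/3)r³ρ`
velocities present in the `r`-ball at the collision time `s`.  The state at `s` is POST-collisional, so `hm(v⁺), hm(w⁺)`
carry the self-spikes of `i, j`, but the PRE-velocities `v⁻, w⁻` are velocities of NO particle at time `s`: nothing bounds
`hm(v⁻)` below except the Gaussian tails of the other samples.
* depth of the collision process: `(N+1)·ν_N τ ≍ σ² (N+1)^{4/3}` collisions in `[0,τ]`, a particle of speed `u` colliding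
  at rate `∝ u`; the number with a pre-speed `> u` is `𝒩(u) ≈ C₁ (N+1)^{4/3} u² e^{−u²/2θ}`,
  `C₁ = 4π²σ²Yτθ(2πθ)^{−3/2}`, so pre-speeds up to `s² ≈ (8/3) θ log N` OCCUR (w.h.p., `𝒩(s) → ∞` slowly if wished);
* depth of the ball sample: `n_b` i.i.d. `M_θ` velocities (Gibbs ⊗ Palm: the other particles are independent of the
  colliding pair) reach only `v_max² ≈ 2θ log n_b = 2θ log N + O(1)`;
* hence the deepest collisions have `d := |v⁻| − v_max ≈ (√(8/3) − √2) √(θ log N) = 0.2187 √(θ log N) → ∞`, and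
  `hm(v⁻) ≲ (N+1)^{−1} (3/πr³)(2πϑ²)^{−3/2} e^{−d²/2ϑ²}·O(1)` (nearest sample at distance `≥ d`), while `w⁻, v⁺, w⁺` are in
  the well-sampled bulk for the half of the impact geometries that split the energy (`cos²α ∈ [1/4,3/4]`), where
  `hm ≈ ρ M_{θ+ϑ²}`; energy conservation then gives `e^{−F} ≈ ρ M_{θ+ϑ²}(v⁻)/hm(v⁻)
  ≈ ρ(N+1)(πr³/3)(ϑ²/θ)^{3/2} exp(d²/2ϑ² − s²/2θ)`;
* ONE such collision contributes `T = (ε/(N+1))·Ψ·(1+e^{−F})` with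
  `log T ≈ −(1/3)log N + d²/(2ϑ²) − s²/(2θ) + O(1) = log N · (0.02392·θ/ϑ² − 5/3) + O(log log N)`
  (`s²/2θ = (4/3) log N + O(log log N)` from `𝒩(s) ≍ 1`, `d²/2ϑ² = 0.02392 (θ/ϑ²) log N`);
* so for `ϑ < 0.1198 √θ` (any FIXED such `ϑ`; the crux lets the refuter take `ϑ ∈ (0, r₀)` as small as wanted AFTER `r₀`),
  `T → +∞` polynomially in `N`.  With the bounded continuous J-odd mark `Ψ = tanh((|v|⁴+|w|⁴−|v′|⁴−|w′|⁴)/10)`, which is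
  `≈ +1` on every energy-equalising collision (all large-weight collisions are of this type: the fast particle is PRE), and
  `≤ O(1)`-weighted on their J-images (a fast POST velocity carries its self-spike, bulk pre-velocities are well sampled),
  `D ≥ T − O_P(1) → ∞` in probability: `P(|D| > η) → 1`, contradicting the crux for every `δ < 1`.  With the crude bound
  "all `n_b` samples at distance `d`" instead of the nearest one the threshold is `ϑ < 0.0947 √θ` (`8/3` for `5/3`).
* A cleaner mark for a proof: `Ψ = κ(e,e′) − κ(e′,e)` with `e = |v|²/(|v|²+|w|²)` (pre energy share), `e′` the post
  share, `κ(x,y)` a continuous bump `≈ 1_{x ≥ 0.9}·1_{0.35 ≤ y ≤ 0.65}` — J-odd because `J` swaps `(e,e′)`.  Then `Ψ = +1`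
  exactly on "dominant pre-particle, balanced post split" (the blow-up collisions: pre-velocity beyond the cloud, post
  energies `≤ 0.65 s² = 1.73 θ log N < v_max²`, sampled), `Ψ = −1` on the J-images "balanced pre → dominant post", whose
  weight is `≤ A/((N+1)ρM(v⁺))` (self-spike `A = (3/πr³)(2πϑ²)^{−3/2}` in the NUMERATOR, sampled pre-velocities): their
  total is `O_P(N^{−1} log² N)`; and `Ψ = 0` on the delicate "slightly energy-concentrating fast-pre" collisions.  So
  `D ≥ T_max − O_P(1)` with no sign competition.
* Finite `N`: the corrections to `s² − v_max²` are `2θ[log(C₁s²) − log(4.19 r³) − (3/2)log(ϑ²/θ)] ≈ +16θ` at `σ = 0.5,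
  τ = 0.25, r = 0.2, ϑ = 0.3` — at every simulable `N` EVERY `ϑ` is in the blow-up regime; smoke run kit `j008036`
  (Np = 216, 512): `rms F ≈ 9–27`, `max|F| ≈ 33–85`, raw `D/K_N[1] ≈ 10^{21}–10^{51}` for all six marks, unweighted
  `|D_u/K_N[1]| ≤ 0.09`.  Matrix `j013997` / scaling `j014000` report `log₁₀ W_max`, K-mass above `L`, worst-collision
  pre-speed / `d_min` / `v_max(ball)` per `(r,ϑ)` (numbers in NOTES.md / item evidence when they land).

### Consequences
* The crux AS TYPED (untruncated `1 + e^{−F}`, Gaussian kernel, `∀ ϑ < r₀`) is false at rung 0 already — nothing to do with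
  parity or dynamics subtleties; classification if it could be landed: `refuted-misstated`.  Landing it needs the law of the
  collision point process of the `N`-sphere flow under Gibbs (flux/Palm identity + a second-moment bound) — the flow itself
  IS constructible (`Literature.Analysis.FluidPDE.HardSphereFlow.nonempty_torus_holds`, Alexander, sorry-free in tree), the
  quantitative collision statistics are not in the tree.  Not filed as `¬S`; filed as this analysis + numerics + the
  `stub-misstated` note on the lead's S1 `stub_reweightingTight` (false for `ϑ < 0.12√θ` at fixed `L`, same mechanism:
  `D − D_L` keeps the blow-up terms).
* REPAIR (typed below): cut the weight off J-SYMMETRICALLY in `F` — `F` is exactly J-odd (`F(Jq) = −F(q)`), so any even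
  cutoff `ζ_L(F) = max 0 (min 1 (L+1−|F|))` preserves the parity structure (`cutoff_reweighted_odd_residual`) while bounding
  the weight by `1 + e^{L+1}`; quantify `∀ L ≥ 1` before `∀ η δ`.  Limit content: `∫Ψ ζ_L(F̄)(ab′−a′b)(1/b+1/b′) = 0 ∀ L, Ψ`
  ⟺ twisted balance — unchanged.  The lead's PLAIN truncation `min(1+e^{−F}, L)` is NOT J-compatible
  (`truncation_breaks_parity`: balanced data `a=1,b=1,a′=4,b′=4`, `L=2` give weights `2 ≠ 5`); its limit carries a spurious
  odd part `O(F̄)` near the threshold — harmless in the `r₀(η)` pattern before shocks (`F̄ = O(r)`), but not exact.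
* A heavy-tailed velocity kernel (polynomial tails) instead of `localMaxwellian 1 ϑ²` would also kill the blow-up
  (`M_θ/h → 0` in the tail) at the price of §4's exactness; a `ϑ`-floor tied to `θ` (`ϑ ≥ 0.12 sup √θ`) is the ugly fix.
-/

/-- The blow-up exponent: with the nearest-sample estimate, one deepest-tail collision contributes
`T ≍ N^{0.02392·θ/ϑ² − 5/3}`, which diverges iff `ϑ² < 0.014352·θ`, e.g. for every `ϑ < 0.1198 √θ`.  (Arithmetic only;
the probabilistic content is in the module docstring above.) [folklore] -/
theorem tail_blowup_exponent_pos {θ ϑ : ℝ} (hϑ : 0 < ϑ) (h : ϑ ^ 2 < 0.014352 * θ) :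
    0 < 0.02392 * θ / ϑ ^ 2 - 5 / 3 := by
  have hϑ2 : 0 < ϑ ^ 2 := by positivity
  rw [sub_pos, lt_div_iff₀ hϑ2]
  nlinarith

/-- **Plain truncation is not J-compatible.**  Even at EXACT twisted balance `a b′ = a′ b` the truncated weights
`a·min(1 + b′/b, L)` and `a′·min(1 + b/b′, L)` differ: `a = b = 1`, `a′ = b′ = 4`, `L = 2` give `2 ≠ 5`.  So
`K_N[χ g Ψ min(1+e^{−F}, L)]` has a limit with a non-zero J-odd part wherever `F̄ ≠ 0`, of size `O(F̄)` near the
threshold. [folklore] -/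
theorem truncation_breaks_parity :
    ∃ a a' b b' L : ℝ, 0 < b ∧ 0 < b' ∧ 1 ≤ L ∧ a * b' = a' * b ∧
      a * min (1 + b' / b) L ≠ a' * min (1 + b / b') L := by
  refine ⟨1, 4, 1, 4, 2, one_pos, by norm_num, by norm_num, by norm_num, ?_⟩
  norm_num [min_eq_right, min_eq_left]

/-- **A J-symmetric cutoff preserves the parity structure.**  For any common factor `ζ` (in the crux: an even function of
the exactly J-odd surprisal jump `F`, e.g. `ζ_L(F) = max 0 (min 1 (L+1−|F|))`), the odd residual of the cut-off weight is
`ζ·(ab′ − a′b)(1/b + 1/b′)`: zero iff twisted balance, at every level `L`. [folklore] -/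
theorem cutoff_reweighted_odd_residual (a a' b b' ζ : ℝ) (hb : b ≠ 0) (hb' : b' ≠ 0) :
    a * ((1 + b' / b) * ζ) - a' * ((1 + b / b') * ζ) = ζ * ((a * b' - a' * b) * (1 / b + 1 / b')) := by
  field_simp
  ring

/-- The cutoff `ζ_L(F) = max 0 (min 1 (L+1−|F|))` is even in `F`, valued in `[0,1]`, `= 1` on `|F| ≤ L` and `= 0` on
`|F| ≥ L+1`; with it the weight is bounded: `(1 + e^{−F})·ζ_L(F) ≤ 1 + e^{L+1}`. [folklore] -/
theorem cutoff_weight_bounded (F L : ℝ) :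
    (1 + Real.exp (-F)) * max 0 (min 1 (L + 1 - |F|)) ≤ 1 + Real.exp (L + 1) := by
  by_cases h : L + 1 - |F| ≤ 0
  · have : max 0 (min 1 (L + 1 - |F|)) = 0 := by
      rw [max_eq_left]; exact le_trans (min_le_right _ _) h
    rw [this, mul_zero]; positivity
  · push Not at h
    have hF : -F ≤ L + 1 := by
      have := neg_abs_le F
      linarith
    have h1 : max 0 (min 1 (L + 1 - |F|)) ≤ 1 := max_le zero_le_one (min_le_left _ _)
    have h0 : 0 ≤ max 0 (min 1 (L + 1 - |F|)) := le_max_left _ _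
    have hpos : 0 ≤ 1 + Real.exp (-F) := by positivity
    calc (1 + Real.exp (-F)) * max 0 (min 1 (L + 1 - |F|)) ≤ (1 + Real.exp (-F)) * 1 :=
          mul_le_mul_of_nonneg_left h1 hpos
      _ ≤ 1 + Real.exp (L + 1) := by rw [mul_one]; gcongr

/-- **C″ = the crux with the J-symmetric cutoff** `ζ_L(F) = max 0 (min 1 (L + 1 − |F|))` on the weight and `∀ L ≥ 1`
quantified before `∀ η δ` (verbatim otherwise).  Immune to the §7 blow-up (weights `≤ 1 + e^{L+1}`), same limit content
(twisted balance, by `cutoff_reweighted_odd_residual` and `L → ∞`).  Not comparable with the crux by pure logic (different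
statistic); recommended re-filing, together with the `τ < T` restriction of §5. [folklore] -/
def OddContactSymmetryCutoff : Prop :=
  ∃ η₀ : ℝ, 0 < η₀ ∧ ∀ (a₀ θ₀ : Literature.MathematicalPhysics.KineticTheory.T3 → ℝ) (u₀ : Literature.MathematicalPhysics.KineticTheory.T3 → Literature.MathematicalPhysics.KineticTheory.V3), Continuous a₀ → Continuous θ₀ → Continuous u₀ → (∀ x, 0 < a₀ x) → (∀ x, 0 < θ₀ x) → ∃ σ₀ : ℝ, 0 < σ₀ ∧ ∀ σ : ℝ, 0 < σ → σ < σ₀ → ∀ Φ : (N : ℕ) → Literature.Analysis.FluidPDE.HardSphereFlow (Literature.Analysis.FluidPDE.Torus.geometry (Fin 3)) (Literature.MathematicalPhysics.KineticTheory.hsDiameter σ N) (N + 1), ∀ τ : ℝ, 0 < τ → ∀ χ : ℝ × UnitAddTorus (Fin 3) → ℝ, Continuous χ → ∀ g : ℝ → ℝ, Continuous g → (∀ a, η₀ ≤ a → g a = 0) → ∀ Ψ : EuclideanSpace ℝ (Fin 3) × EuclideanSpace ℝ (Fin 3) × EuclideanSpace ℝ (Fin 3) → ℝ, Continuous Ψ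 → (∃ C : ℝ, ∀ q, |Ψ q| ≤ C) → (∀ (n v w : EuclideanSpace ℝ (Fin 3)), ‖n‖ = 1 → Ψ (-n, (Literature.Analysis.FluidPDE.reflectVel n (v, w)).1, (Literature.Analysis.FluidPDE.reflectVel n (v, w)).2) = -Ψ (n, v, w)) → ∀ L : ℝ, 1 ≤ L → ∀ η δ : ℝ, 0 < η → 0 < δ → ∃ r₀ : ℝ, 0 < r₀ ∧ ∀ r ϑ : ℝ, 0 < r → r < r₀ → 0 < ϑ → ϑ < r₀ → ∃ N₀ : ℕ, ∀ N : ℕ, N₀ ≤ N → let ε := Literature.MathematicalPhysics.KineticTheory.hsDiameter σ N; let G := Literature.Analysis.FluidPDE.Torus.geometry (Fin 3); let γ := fun z (s : ℝ) => (Φ N).flow s z; let bx : UnitAddTorus (Fin 3) → UnitAddTorus (Fin 3) → ℝ := fun x y => 3 / (Real.pi * r ^ 3) * max (1 - Literature.Analysis.FluidPDE.Torus.euclidDist x y / r) 0; let ρm := fun z s (x₀ : UnitAddTorus (Fin 3)) => ∫ q, bx q.1 x₀ ∂(Literature.Analysis.FluidPDE.empiricalMeasure (γ z s)); let hm := fun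 z s (x₀ : UnitAddTorus (Fin 3)) (v : EuclideanSpace ℝ (Fin 3)) => ∫ q, bx q.1 x₀ * Literature.Analysis.FluidPDE.localMaxwellian 1 (ϑ ^ 2) v q.2 ∂(Literature.Analysis.FluidPDE.empiricalMeasure (γ z s)); let pv := fun z s (i j : Fin (N + 1)) => Literature.Analysis.FluidPDE.reflectVel (G.sepVec (γ z s i).1 (γ z s j).1) ((γ z s i).2, (γ z s j).2); let F := fun z s (i j : Fin (N + 1)) => Real.log (hm z s (γ z s i).1 (pv z s i j).1) + Real.log (hm z s (γ z s i).1 (pv z s i j).2) - Real.log (hm z s (γ z s i).1 (γ z s i).2) - Real.log (hm z s (γ z s i).1 (γ z s j).2); let Kc := fun (Fn : Literature.Analysis.FluidPDE.Config (N + 1) (Fin 3) Literature.MathematicalPhysics.KineticTheory.T3 → ℝ → Fin (N + 1) → Fin (N + 1) → ℝ) z => ε / (N + 1 : ℝ) * ∑ᶠ (s : ℝ) (_ : s ∈ Literature.Analysis.FluidPDE.collisionTimes G ε (γ z) ∩ Set.Icc 0 τ), ∑ i : Fin (N + 1), ∑ j : Fin (N + 1), (if i ≠ j ∧ ‖G.sepVec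 (γ z s i).1 (γ z s j).1‖ = ε then Fn z s i j else 0); let D := fun z => Kc (fun z s i j => χ (s, (γ z s i).1) * g (σ ^ 3 * ρm z s (γ z s i).1) * (Ψ (ε⁻¹ • G.sepVec (γ z s i).1 (γ z s j).1, (pv z s i j).1, (pv z s i j).2) * ((1 + Real.exp (-F z s i j)) * max 0 (min 1 (L + 1 - |F z s i j|))))) z; Literature.MathematicalPhysics.KineticTheory.localGibbsLaw σ a₀ u₀ θ₀ N (Φ N) {z | η < |D z|} ≤ ENNReal.ofReal δ

/-- **C‴ = C′ ∧ C″ combined**: the crux before the first shock (classical hs-Euler solution on `[0,T)`, `t = 0` LLN,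
`τ < T`) AND with the J-symmetric cutoff on the weight.  This is the statement the standing adversary cannot attack with
ANY mechanism found in cycle 1 (§3 needs wild limits, excluded by `τ < T`; §7 needs unbounded weights, excluded by
`ζ_L`), and it is all the glue `ParityInBand` consumes. [folklore] -/
def OddContactSymmetryRepaired : Prop :=
  ∃ η₀ : ℝ, 0 < η₀ ∧ ∀ (a₀ θ₀ : Literature.MathematicalPhysics.KineticTheory.T3 → ℝ) (u₀ : Literature.MathematicalPhysics.KineticTheory.T3 → Literature.MathematicalPhysics.KineticTheory.V3), Continuous a₀ → Continuous θ₀ → Continuous u₀ → (∀ x, 0 < a₀ x) → (∀ x, 0 < θ₀ x) → ∃ σ₀ : ℝ, 0 < σ₀ ∧ ∀ σ : ℝ, 0 < σ → σ < σ₀ → ∀ (T : ℝ) (ρ θ : ℝ → Literature.MathematicalPhysics.KineticTheory.T3 → ℝ) (u : ℝ → Literature.MathematicalPhysics.KineticTheory.T3 → Literature.MathematicalPhysics.KineticTheory.V3), Literature.MathematicalPhysics.KineticTheory.IsHardSphereEulerSolution σ T ρ u θ → ∀ Φ : (N : ℕ) → Literature.Analysis.FluidPDE.HardSphereFlow (Literature.Analysis.FluidPDE.Torus.geometry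 (Fin 3)) (Literature.MathematicalPhysics.KineticTheory.hsDiameter σ N) (N + 1), Literature.MathematicalPhysics.KineticTheory.TendstoHydroFieldsAt (fun N => Literature.MathematicalPhysics.KineticTheory.localGibbsLaw σ a₀ u₀ θ₀ N (Φ N)) Φ ρ u θ 0 → ∀ τ : ℝ, 0 < τ → τ < T → ∀ χ : ℝ × UnitAddTorus (Fin 3) → ℝ, Continuous χ → ∀ g : ℝ → ℝ, Continuous g → (∀ a, η₀ ≤ a → g a = 0) → ∀ Ψ : EuclideanSpace ℝ (Fin 3) × EuclideanSpace ℝ (Fin 3) × EuclideanSpace ℝ (Fin 3) → ℝ, Continuous Ψ → (∃ C : ℝ, ∀ q, |Ψ q| ≤ C) → (∀ (n v w : EuclideanSpace ℝ (Fin 3)), ‖n‖ = 1 → Ψ (-n, (Literature.Analysis.FluidPDE.reflectVel n (v, w)).1, (Literature.Analysis.FluidPDE.reflectVel n (v, w)).2) = -Ψ (n, v, w)) → ∀ L : ℝ, 1 ≤ L → ∀ η δ : ℝ, 0 < η → 0 < δ → ∃ r₀ : ℝ, 0 < r₀ ∧ ∀ r ϑ : ℝ, 0 < r → r < r₀ →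 0 < ϑ → ϑ < r₀ → ∃ N₀ : ℕ, ∀ N : ℕ, N₀ ≤ N → let ε := Literature.MathematicalPhysics.KineticTheory.hsDiameter σ N; let G := Literature.Analysis.FluidPDE.Torus.geometry (Fin 3); let γ := fun z (s : ℝ) => (Φ N).flow s z; let bx : UnitAddTorus (Fin 3) → UnitAddTorus (Fin 3) → ℝ := fun x y => 3 / (Real.pi * r ^ 3) * max (1 - Literature.Analysis.FluidPDE.Torus.euclidDist x y / r) 0; let ρm := fun z s (x₀ : UnitAddTorus (Fin 3)) => ∫ q, bx q.1 x₀ ∂(Literature.Analysis.FluidPDE.empiricalMeasure (γ z s)); let hm := fun z s (x₀ : UnitAddTorus (Fin 3)) (v : EuclideanSpace ℝ (Fin 3)) => ∫ q, bx q.1 x₀ * Literature.Analysis.FluidPDE.localMaxwellian 1 (ϑ ^ 2) v q.2 ∂(Literature.Analysis.FluidPDE.empiricalMeasure (γ z s)); let pv := fun z s (i j : Fin (N + 1)) => Literature.Analysis.FluidPDE.reflectVel (G.sepVec (γ z s i).1 (γ z s j).1) ((γ z s i).2, (γ z s j).2); let F := fun z s (i j : Fin (N + 1)) => Real.log (hm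 z s (γ z s i).1 (pv z s i j).1) + Real.log (hm z s (γ z s i).1 (pv z s i j).2) - Real.log (hm z s (γ z s i).1 (γ z s i).2) - Real.log (hm z s (γ z s i).1 (γ z s j).2); let Kc := fun (Fn : Literature.Analysis.FluidPDE.Config (N + 1) (Fin 3) Literature.MathematicalPhysics.KineticTheory.T3 → ℝ → Fin (N + 1) → Fin (N + 1) → ℝ) z => ε / (N + 1 : ℝ) * ∑ᶠ (s : ℝ) (_ : s ∈ Literature.Analysis.FluidPDE.collisionTimes G ε (γ z) ∩ Set.Icc 0 τ), ∑ i : Fin (N + 1), ∑ j : Fin (N + 1), (if i ≠ j ∧ ‖G.sepVec (γ z s i).1 (γ z s j).1‖ = ε then Fn z s i j else 0); let D := fun z => Kc (fun z s i j => χ (s, (γ z s i).1) * g (σ ^ 3 * ρm z s (γ z s i).1) * (Ψ (ε⁻¹ • G.sepVec (γ z s i).1 (γ z s j).1, (pv z s i j).1, (pv z s i j).2) * ((1 + Real.exp (-F z s i j)) * max 0 (min 1 (L + 1 - |F z s i j|))))) z; Literature.MathematicalPhysics.KineticTheory.localGibbsLaw σ a₀ u₀ θ₀ N (Φ N) {z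 | η < |D z|} ≤ ENNReal.ofReal δ

/-- C″ implies C‴ (the before-shock hypotheses are simply ignored). [folklore] -/
theorem oddContactSymmetryCutoff_imp_repaired (h : OddContactSymmetryCutoff) : OddContactSymmetryRepaired := by
  obtain ⟨η₀, hη₀, H⟩ := h
  refine ⟨η₀, hη₀, ?_⟩
  intro a₀ θ₀ u₀ ha hθ hu hpa hpθ
  obtain ⟨σ₀, hσ₀, Hσ⟩ := H a₀ θ₀ u₀ ha hθ hu hpa hpθ
  refine ⟨σ₀, hσ₀, ?_⟩
  intro σ hσ hσσ T ρ θ u _hsol Φ _hlln τ hτ _hτT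
  exact Hσ σ hσ hσσ Φ τ hτ

/-! ## §8  (HISTORY + still valid) Cycle 2 (gen-2 seat `refuter-cdisprove-stmt-AtomisticToContinuum-13078-g2-0`, 2026-08-16)

Rev-5 status of this section: §8.1's hole anatomy now bounds what `min` DISCARDS (the clipped collisions are the
`N^{1/3−a}`-band, a vanishing FRACTION `N^{−1−a}` of all collisions, so discarding them costs nothing in the limit); §8.2's audit
is what the planner adopted (C′₃ ∧ §5); §8.3's `Ψ⋆` remains the admissible sign-clean witness mark for the rev-5 falsifier.

### §8.1  Anatomy of a kernel `¬S` — why the blow-up cannot be landed, quantified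

The velocity-hole blow-up of §7 is carried not by one collision but by a whole band of them.  Parametrise a collision's
fast pre-speed by `u² = 2(1+a)θ ln N`.  Its isolation from the `r`-ball cloud (local Poisson edge statistics, density higher
towards the origin) is `d(a) ≈ a√(θ ln N)/√(2(1+a))` (the hard-edge model of §7 gives `(√(1+a) − 1)√(2θ ln N)`; same
ballpark, `0.204` vs `0.219 √(θ ln N)` at `a = 1/3`), so by `VelocityHoleInBall.exp_neg_surprisal_ge_rhoMoll_inBall` and
energy conservation its term is `≈ N^{−4/3 − a + a²θ/(4(1+a)ϑ²)}`, and there are `≈ N^{1/3 − a}·polylog` such collisions in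
`[0, τ]` (flux `∝ u·M_θ(u)`).  Level `a` therefore contributes `N^{e(a)}`, `e(a) = −1 − 2a + a²θ/(4(1+a)ϑ²)`, positive iff
`a > a*(ϑ) = (6ϑ² + 2ϑ√(θ + ϑ²))/(θ − 8ϑ²) ≈ 2ϑ/√θ`.  Consequences:
* for every fixed `ϑ < 0.1√θ` the band `a*(ϑ) < a < 1/3` carries `N^{1/3 − a} → ∞` blow-up collisions — the divergence is
  robust (not an artefact of the single top term) and gets WORSE as the adversary lowers `ϑ` after `r₀`;
* but per MEAN FREE TIME (`≍ N^{−1/3}/(σ²√θ)`) the number of collisions at level `≥ a` is `≈ N^{−a}(1+a) ln N → 0` for every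
  `a > 0` (and `≈ ln N` exactly at the cloud edge `a = 0`, where the isolation and hence the weight are `O(1)`): there is NO
  fixed-time witness (lead a1-0 §2) and NO perturbative-window witness either — even a Lanford-type control of the
  deterministic flow over a fraction of a mean free time would contain no blow-up collision.  A kernel `¬S` needs the
  equilibrium gas over `≳ N^{a*(ϑ)}` mean free times;
* ANATOMY.  With the sign-clean mark `Ψ⋆` of §8.3 a kernel `¬S` decomposes into: (H) HoleOccurrence — with probability
  `≥ 3/4` some collision in `[0, τ]` has pre-speed level `≥ a₁ > a*`, energy split in `[0.3, 0.7]` and an `r`-ball cloud below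
  level `a₁/2` (equivalently, up to first-moment corrections, the extreme-value law `sup_{t ≤ τ} max_k ‖v_k(t)‖² ≥
  2(1+a₁)θ ln N` w.h.p. for the hard-sphere flow at equilibrium) — a TWO-TIME statement, not in tree or print;
  (F) NoInCloudHoles — every collision in `[0, τ]` whose mark is negative (the inverse, energy-concentrating collisions:
  balanced moderately fast pre-pair) has pre-velocities with `≥ 1` ball velocity within `O(ϑ)`, so its weight is
  `≤ N^{1/3+o(1)}` and its term `≤ σN^{−1+o(1)}` — a FIRST-MOMENT statement (flux bound
  `Literature…CollisionFluxUpperBound.measure_collisionSum_ge_le_liminf` + static contact-conditioned Gibbs tails), and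
  VERBATIM the transfer debt S1′ of the repair C′₁ (the all-collision-instants KDE floor, here on the moderately fast shell);
  (C) static caps (collision count `≤ N^{4/3} ln N`: `JParityClosureOddContactSymmetryCollisionCountBound`, p88212; energy;
  occupation).  So `¬`(filed crux) = HoleOccurrence + the lemma that PROVES C′₁ at rung 0.  F is worth building iff the
  planner re-files C′₁; under C′₃ / C″ nobody needs it, and H stays a research problem either way.
* In print (searched 2026-08-16, searchd/galaxy degraded, arXiv direct): the speed-proportional collision rate and the
  flux-weighted speed law of colliding particles (`∝ u³e^{−u²/2θ}`, whence `P(u² ≥ 2L) = (L+1)e^{−L}` above) are standard kinetic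
  theory (Visco–van Wijland–Trizac, *Collisional statistics of the hard-sphere gas*, Phys. Rev. E 77 (2008) 041117,
  arXiv:0803.1291 — non-rigorous, with MD); rigorous dynamical fluctuation / large-deviation control of the hard-sphere gas
  exists only in the Boltzmann–Grad scaling on Lanford's time window (Bodineau–Gallagher–Saint-Raymond–Simonella,
  arXiv:2008.10403); nothing reaches H (fixed reduced density, `≳ N^{a*}` mean free times).

### §8.2  Audit of the repairs in circulation (input to the re-filing; two Negative files landed)

* **Sub-unit parity-exact weights** (`Theorems/OddContactSymmetry/Negative/ParityExactWeights.lean`, p107061).  In the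
  dictionary of §2 (`R = e^{−F} = b′/b`) a weight `m(R)` is PARITY-EXACT — its `J`-odd residual `a·m(b′/b) − a′·m(b/b′)`
  vanishes at exact twisted balance — iff `m R = R·m R⁻¹` (`parityExact_iff`) iff `t ↦ e^{−t/2} m(e^t)` is even
  (`parityExact_iff_even`); then the residual FACTORS, `m(b′/b)·(ab′ − a′b)/b′` (`parityExact_residual`), so every positive
  member has EXACTLY the filed crux's limit content `ab′ = a′b` (`parityExact_residual_eq_zero_iff`).  Members: `1 + R`
  (filed, unbounded), `min 1 R` (Metropolis, C′₃), `R/(1+R)` (Barker), `m·ζ` for inversion-symmetric `ζ` (the cutoff family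
  C″ of §7) — `parityExact_one_add/min/barker/mul_symm`, closed residuals `metropolis_residual` (`(ab′−a′b)/max(b,b′)`),
  `barker_residual` (`(ab′−a′b)/(b+b′)`); NON-member: the truncation `min (1+R) L` (C′₂; `not_parityExact_trunc`, cf.
  `TruncationResidual.lean`).  Order: Metropolis is the pointwise MAXIMUM of the sub-unit members
  (`le_min_of_parityExact_le_one`) — the correct form of card metropolis-min-weight's "unique bounded parity-exact twist",
  which is false as stated (`not_unique_subunit_parityExact`: Barker).  For every sub-unit member `|D_N| ≤ ‖χ g Ψ‖_∞ K_N[1]`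
  pathwise, so tightness = collision-count tightness (`collisionTightness_rung0`, p88324) — no KDE floor, no hole law, no shell.
* **C′₁ (energy-shell marks, weight `1 + e^{−F}` kept) is not configuration-wise bounded**
  (`Theorems/OddContactSymmetry/Negative/VelocityHoleInBall.lean`, p107346).  `hMoll_le_of_isolated_inBall` is the hole lemma
  with the right hypothesis (isolation from the velocities of the particles INSIDE the open `r`-ball only; lead-0's
  `hMoll_le_of_isolated` asks isolation from all `N+1` velocities, too weak for §7 where far particles do populate the deep
  tail); `depletedBall_weight_ge`: a colliding pair ALONE in its `r`-ball weighs `e^{−F} ≥ (1−ε/r)/4 · e^{(d₁²+d₂²)/2ϑ²}`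
  INDEPENDENTLY of `N`, with `d₁, d₂` the distances of the pre- from the two post-velocities — thermal momentum transfers
  `|⟨g,n̂⟩|`, `‖g_⊥‖`; all four queries on one energy shell.  E.g. `|⟨g,n̂⟩| = ‖g_⊥‖ = 1`, `ϑ = 0.05`: weight `≥ 0.2·e^{400}`.  At
  rung 0 such configurations are asymptotically negligible (depletion costs `e^{−c r³N}`, an in-cloud hole on the shell
  `e^{−c r³ϑ³e^{−R/2θ}N}`, times `N^{4/3}` collisions), so C′₁ is presumably TRUE there — but (a) its proof owes F = S1′
  uniformly over all collision instants (first moment + statics, not in tree), (b) it fails at every simulable `N`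
  (`c r³ϑ³e^{−R/2θ} N ≫ (4/3) ln N` needs `N ≳ 10^{16}` at `r = ϑ = 0.01`, `R = 10θ`): no EDMD run can support C′₁, whereas
  C′₃/C″ statistics are `O(K_N[1])` at every `N` (their finite-`N` equilibrium KDE biases are `O(0.01–0.15)` at `N ≤ 2.2·10⁴`,
  j013997, and decay).
* **Cheap attacks run on C′₃ / C″ — all survive.**  (1) Rung 0, fixed `(r, ϑ)`, `N → ∞`: bulk weights → `min(1, e^{−F̄})` with
  `F̄ ≡ 0` (§4: `M_θ ⋆ G_ϑ = M_{θ+ϑ²}` is log-quadratic), tail fraction `→ 0` with weight `≤ 1`; the self-spike asymmetry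
  (spikes in the numerator only, §7) and the Jensen bias at the kink of `min(1,·)` are `O((N r³ϑ³)^{−1/2}) + O(N^{−1/3}polylog)`.
  (2) The adversary's `(r, ϑ)` freedom (`ϑ ≪ r` or `r ≪ ϑ`, both below `r₀`, `N → ∞` last): before shocks the limit statistic is
  `D̄₃(r,ϑ) = ∫ χ g Ψ (ab′ − a′b)/max(b,b′)` with `a = Y f f_*` (local-equilibrium incoming chaos, `f` the local Maxwellian — for
  which `f f_* = f′f′_*` in the local frame) and `b, b′` from `h = (f̄_r) ⋆ G_ϑ`, an `r`-MIXTURE of Maxwellians: the bulk defect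
  `|1 − min/max|` is `O(r²(|∇θ|² + |∇u|²))`, the `O(1)` defect sits in tails of Maxwellian mass `≈ e^{−θ/(2 r |∇θ|)}` (the
  mixture's tail is the hottest component's), and `ϑ` never hurts (§4) ⇒ `D̄₃ → 0` as `r → 0` uniformly in `ϑ`; the §3
  witnesses (`mixture_mollifier_breaks_twisted_balance`, `anisotropic_…`) are exactly these `O(r²)`/tail terms.  (3) Kinetic
  corrections: the Chapman–Enskog deviation `f = f_LE(1 + Kn φ₁)` makes the incoming contact correlation J-ODD at order `Kn`
  (`φ₁ + φ₁* ≠ φ₁′ + φ₁*′`, `φ₁ ⟂` collision invariants) — an honest odd signal `≈ c·Kn·K_N[1]`, seen in the numerics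
  (`0.15–0.2·Kn` on shear / travelling-wave data, j013997) and vanishing as `N → ∞` (`Kn = N^{−1/3}/(√2πσ²)`); ring /
  mode-coupling corrections at fixed reduced density `σ³` are `O(σ³·Kn)` around LOCAL equilibrium (they vanish identically at
  global equilibrium, where the Gibbs law factorises at equal times).  (4) Junk / edge parameters: none new (`hm > 0`, finsum
  finite on `Φ.good`, `localGibbsLaw` a probability measure `≪` Liouville for `σ < 1/2`, flows pinned a.e. by
  `IsHardSphereTrajectory`, `r > 1/2` only weakens the prover's side).  What is left is the crux's INTENDED content — the
  `O(1)` incoming contact correlation of the `Kn → 0` limit is `J`-even iff the local state is local-Gibbs at the kinetic scale,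
  i.e. the hydrodynamic-limit picture itself; no mechanism for an `O(1)` J-odd correlation ("fake equilibrium") is known or
  constructible — and, post-shock, the §3 wild-limit mechanism, which C′₃/C″ do NOT exclude (weight `≤ 1`, but a mixture defect
  of `O(1)` amplitude on `O(1)` volume moves `D̄₃` by `O(1)`): conjoin §5 (`τ < T`).
* **Adversary's recommendation to the planner**: re-file as C′₃ (`min 1 (Real.exp (-F …))`, card metropolis-min-weight's
  `OddContactSymmetryMinWeight`) or C″ (`OddContactSymmetryCutoff`, §7) ∧ §5 (`τ < T` with the `t = 0` LLN, as `ParityInBand`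
  uses it).  C′₁ alone is true-but-expensive (owes S1′) and numerically unsupportable; C′₂ changes the content.

### §8.3  The sign-clean admissible witness mark `Ψ⋆` (for any future kernel `¬S` or EDMD falsifier)

`psiStar A (n, v, w) = A(t(‖v‖², ‖w‖²)) − A(t(‖v♯‖², ‖w♯‖²))`, `t(x, y) = (x − y)/(x + y + 1) ∈ (−1, 1)` the energy-asymmetry
coordinate, `(v♯, w♯) = (v − ⟨v−w, n⟩n, w + ⟨v−w, n⟩n)` the UNNORMALISED reflection (`= reflectVel n (v,w)` at `‖n‖ = 1`,
`reflectVel_of_norm_eq_one`; polynomial, so no `n = 0` singularity).  Checked: continuous for continuous `A`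
(`psiStar_continuous`), `|Ψ⋆| ≤ 2 sup|A|` (`psiStar_bounded`), J-ODD FOR EVERY `A` (`psiStar_J_odd`, via `sharp_involutive`),
EXCHANGE-EVEN for even `A` (`psiStar_exchange_even` — so the ordered twins `(i,j)`, `(j,i)` of one collision carry the same
mark up to the `O(ε/r)` displacement of the reading point instead of cancelling; exchange-ODD marks are useless witnesses), and
with the standard profile `A t = max 0 (min 1 ((10|t| − 4)/3))` (`stdProfile_props`: continuous, even, `[0,1]`-valued, `0` on
`|t| ≤ 2/5`, `1` on `|t| ≥ 7/10`) it equals `+1` on every collision from a strongly imbalanced pre-pair to a balanced post-pair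
(`psiStar_eq_one_of`) — every §7/§8.1 hole collision with energy split in `[0.3, 0.7]` — `−1` on the inverse collisions
(weights `≤ N^{1/3+o(1)}` under F), and `0` on balanced→balanced and imbalanced→imbalanced collisions (in particular on the
energy-CONCENTRATING fast collisions, whose weights are also large and whose sign a `tanh`-type mark does not control).
-/

/-- The energy-asymmetry coordinate `t(x, y) = (x − y)/(x + y + 1)` of a pair of kinetic energies (`∈ (−1,1)` for
`x, y ≥ 0`; the `+1` removes the `0/0` of the energy share at the origin without spoiling scale-freeness at large energies).
[folklore] -/
def asym (x y : ℝ) : ℝ := (x - y) / (x + y + 1)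

/-- The witness mark `Ψ⋆_A(n, v, w) = A(t(‖v‖², ‖w‖²)) − A(t(‖v♯‖², ‖w♯‖²))`, `(v♯, w♯)` the unnormalised reflection
`(v − ⟨v−w,n⟩n, w + ⟨v−w,n⟩n)`. [folklore] -/
def psiStar (A : ℝ → ℝ) (q : V3 × V3 × V3) : ℝ :=
  A (asym (‖q.2.1‖ ^ 2) (‖q.2.2‖ ^ 2)) -
    A (asym (‖q.2.1 - ⟪q.2.1 - q.2.2, q.1⟫_ℝ • q.1‖ ^ 2) (‖q.2.2 + ⟪q.2.1 - q.2.2, q.1⟫_ℝ • q.1‖ ^ 2))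

/-- At unit impact direction the tree's `reflectVel` IS the unnormalised reflection. [folklore] -/
theorem reflectVel_of_norm_eq_one {n : V3} (hn : ‖n‖ = 1) (v w : V3) :
    reflectVel n (v, w) = (v - ⟪v - w, n⟫_ℝ • n, w + ⟪v - w, n⟫_ℝ • n) := by
  simp only [reflectVel, hn, one_pow, div_one]

/-- `Ψ⋆_A` is continuous for continuous `A` (everywhere, including `n = 0`, `v = w = 0`). [folklore] -/
theorem psiStar_continuous {A : ℝ → ℝ} (hA : Continuous A) : Continuous (psiStar A) := by
  unfold psiStar asym
  refine Continuous.sub (hA.comp ?_) (hA.comp ?_)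
  · refine Continuous.div (by fun_prop) (by fun_prop) fun q => ?_
    positivity
  · refine Continuous.div (by fun_prop) (by fun_prop) fun q => ?_
    positivity

/-- `Ψ⋆_A` is bounded by `2 sup|A|`. [folklore] -/
theorem psiStar_bounded {A : ℝ → ℝ} {C : ℝ} (hA : ∀ t, |A t| ≤ C) : ∀ q, |psiStar A q| ≤ 2 * C := by
  intro q
  unfold psiStar
  have h1 := hA (asym (‖q.2.1‖ ^ 2) (‖q.2.2‖ ^ 2))
  have h2 := hA (asym (‖q.2.1 - ⟪q.2.1 - q.2.2, q.1⟫_ℝ • q.1‖ ^ 2) (‖q.2.2 + ⟪q.2.1 - q.2.2, q.1⟫_ℝ • q.1‖ ^ 2))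
  calc |_| ≤ |A (asym (‖q.2.1‖ ^ 2) (‖q.2.2‖ ^ 2))| +
        |A (asym (‖q.2.1 - ⟪q.2.1 - q.2.2, q.1⟫_ℝ • q.1‖ ^ 2) (‖q.2.2 + ⟪q.2.1 - q.2.2, q.1⟫_ℝ • q.1‖ ^ 2))| :=
        abs_sub _ _
    _ ≤ C + C := add_le_add h1 h2
    _ = 2 * C := by ring

/-- The unnormalised reflection is undone by reflecting along `−n` (unit `n`): `J` is an involution on the pre-data.
[folklore] -/
theorem sharp_involutive {n : V3} (hn : ‖n‖ = 1) (v w : V3) :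
    let c := ⟪v - w, n⟫_ℝ
    let v' := v - c • n
    let w' := w + c • n
    v' - ⟪v' - w', -n⟫_ℝ • (-n) = v ∧ w' + ⟪v' - w', -n⟫_ℝ • (-n) = w := by
  intro c v' w'
  have hnn : ⟪n, n⟫_ℝ = 1 := by rw [real_inner_self_eq_norm_sq, hn, one_pow]
  have hc' : ⟪v' - w', n⟫_ℝ = -c := by
    have : v' - w' = (v - w) - (2 * c) • n := by
      simp only [v', w']
      rw [mul_smul, two_smul]
      abel
    rw [this, inner_sub_left, inner_smul_left, hnn]
    simp [c]
    ring
  constructor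
  · rw [inner_neg_right, hc', neg_neg, smul_neg]
    simp only [v']
    rw [sub_neg_eq_add, sub_add_cancel]
  · rw [inner_neg_right, hc', neg_neg, smul_neg]
    simp only [w']
    rw [← sub_eq_add_neg, add_sub_cancel_right]

/-- **`Ψ⋆_A` is J-odd for EVERY profile `A`**: `Ψ⋆(−n, v′, w′) = −Ψ⋆(n, v, w)` for `‖n‖ = 1`,
`(v′, w′) = reflectVel n (v, w)` — the crux's admissibility hypothesis, verbatim. [folklore] -/
theorem psiStar_J_odd (A : ℝ → ℝ) (n v w : V3) (hn : ‖n‖ = 1) :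
    psiStar A (-n, (reflectVel n (v, w)).1, (reflectVel n (v, w)).2) = -psiStar A (n, v, w) := by
  rw [reflectVel_of_norm_eq_one hn]
  obtain ⟨h1, h2⟩ := sharp_involutive hn v w
  simp only [psiStar]
  rw [h1, h2]
  ring

/-- **`Ψ⋆_A` is exchange-even for even `A`**: `Ψ⋆(−n, w, v) = Ψ⋆(n, v, w)`. [folklore] -/
theorem psiStar_exchange_even {A : ℝ → ℝ} (hA : ∀ t, A (-t) = A t) (n v w : V3) :
    psiStar A (-n, w, v) = psiStar A (n, v, w) := by
  have hasym : ∀ x y : ℝ, asym y x = -asym x y := by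
    intro x y
    unfold asym
    rw [← neg_div]
    congr 1 <;> ring
  simp only [psiStar]
  have e1 : w - ⟪w - v, -n⟫_ℝ • (-n) = w + ⟪v - w, n⟫_ℝ • n := by
    rw [inner_neg_right, smul_neg, neg_smul, neg_neg, ← neg_sub v w, inner_neg_left, neg_smul, sub_neg_eq_add]
  have e2 : v + ⟪w - v, -n⟫_ℝ • (-n) = v - ⟪v - w, n⟫_ℝ • n := by
    rw [inner_neg_right, smul_neg, neg_smul, neg_neg, ← neg_sub v w, inner_neg_left, neg_smul, ← sub_eq_add_neg]
  rw [e1, e2, hasym (‖w‖ ^ 2), hA, hasym (‖w + ⟪v - w, n⟫_ℝ • n‖ ^ 2), hA]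

/-- **Sign structure**: with `A = 0` on `[−2/5, 2/5]` and `A = 1` outside `(−7/10, 7/10)`, `Ψ⋆_A = +1` on every collision from
a strongly imbalanced pre-pair (`|t| ≥ 7/10`) to a balanced post-pair (`|t♯| ≤ 2/5`) — every velocity-hole collision of
§7/§8.1 with energy split in `[0.3, 0.7]`. [folklore] -/
theorem psiStar_eq_one_of {A : ℝ → ℝ} (h0 : ∀ t, |t| ≤ 2 / 5 → A t = 0) (h1 : ∀ t, 7 / 10 ≤ |t| → A t = 1)
    (q : V3 × V3 × V3) (hpre : 7 / 10 ≤ |asym (‖q.2.1‖ ^ 2) (‖q.2.2‖ ^ 2)|)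
    (hpost : |asym (‖q.2.1 - ⟪q.2.1 - q.2.2, q.1⟫_ℝ • q.1‖ ^ 2) (‖q.2.2 + ⟪q.2.1 - q.2.2, q.1⟫_ℝ • q.1‖ ^ 2)| ≤ 2 / 5) :
    psiStar A q = 1 := by
  unfold psiStar
  rw [h1 _ hpre, h0 _ hpost, sub_zero]

/-- **The standard profile** `A t = max 0 (min 1 ((10|t| − 4)/3))`: continuous, even, `[0,1]`-valued, `= 0` on `|t| ≤ 2/5`,
`= 1` on `|t| ≥ 7/10` — so `psiStar A` is an ADMISSIBLE mark of the crux (continuous, `|·| ≤ 2`, J-odd) that is exchange-even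
and sign-clean. [folklore] -/
theorem stdProfile_props :
    let A : ℝ → ℝ := fun t => max 0 (min 1 ((10 * |t| - 4) / 3))
    Continuous A ∧ (∀ t, A (-t) = A t) ∧ (∀ t, |A t| ≤ 1) ∧ (∀ t, |t| ≤ 2 / 5 → A t = 0) ∧
      (∀ t, 7 / 10 ≤ |t| → A t = 1) := by
  intro A
  refine ⟨?_, ?_, ?_, ?_, ?_⟩
  · fun_prop
  · intro t; simp [A, abs_neg]
  · intro t
    have h0 : 0 ≤ A t := le_max_left _ _
    have h1 : A t ≤ 1 := max_le zero_le_one (min_le_left _ _)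
    rw [abs_of_nonneg h0]; exact h1
  · intro t ht
    have : (10 * |t| - 4) / 3 ≤ 0 := by linarith
    simp only [A]
    rw [max_eq_left]
    exact le_trans (min_le_right _ _) this
  · intro t ht
    have : 1 ≤ (10 * |t| - 4) / 3 := by linarith
    simp only [A]
    rw [min_eq_left this, max_eq_right zero_le_one]

/-- **The admissible witness, packaged**: there is a mark `Ψ` satisfying the crux's three hypotheses (continuous, bounded,
J-odd) which is moreover exchange-even and takes the value `+1` on every "imbalanced → balanced" collision parameter and `−1`
on every "balanced → imbalanced" one (in the coordinates of `psiStar_eq_one_of`).  Any kernel `¬OddContactSymmetry` along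
§8.1 instantiates the crux's `∀ Ψ` here. [folklore] -/
theorem exists_signClean_admissible_mark :
    ∃ Ψ : V3 × V3 × V3 → ℝ, Continuous Ψ ∧ (∃ C : ℝ, ∀ q, |Ψ q| ≤ C) ∧
      (∀ (n v w : V3), ‖n‖ = 1 → Ψ (-n, (reflectVel n (v, w)).1, (reflectVel n (v, w)).2) = -Ψ (n, v, w)) ∧
      (∀ (n v w : V3), Ψ (-n, w, v) = Ψ (n, v, w)) ∧
      (∀ q : V3 × V3 × V3, 7 / 10 ≤ |asym (‖q.2.1‖ ^ 2) (‖q.2.2‖ ^ 2)| →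
        |asym (‖q.2.1 - ⟪q.2.1 - q.2.2, q.1⟫_ℝ • q.1‖ ^ 2) (‖q.2.2 + ⟪q.2.1 - q.2.2, q.1⟫_ℝ • q.1‖ ^ 2)| ≤ 2 / 5 →
        Ψ q = 1) := by
  obtain ⟨hc, he, hb, h0, h1⟩ := stdProfile_props
  refine ⟨psiStar (fun t => max 0 (min 1 ((10 * |t| - 4) / 3))), psiStar_continuous hc, ⟨2 * 1, psiStar_bounded hb⟩,
    fun n v w hn => psiStar_J_odd _ n v w hn, fun n v w => psiStar_exchange_even he n v w,
    fun q hpre hpost => psiStar_eq_one_of h0 h1 q hpre hpost⟩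

section RevFiveInstanceB
open Literature.Analysis.FunctionSpaces Filter Set
open Summit.AtomisticToContinuum.HydrodynamicLimit.Theorems.PolynomialCompressionPDE

/-! ## §10  Cycle 1 on the RESTATED crux (stmt-17722, rev 5) — instance B of the standing disprover, 2026-08-17

(Two conversations of the seat `refuter-cdisprove-stmt-AtomisticToContinuum-17722-0` ran concurrently on 2026-08-17; §9 is
instance A's port/audit, §10 is instance B's.  Landed companions: `Theorems/OddContactSymmetry/Negative/RevFiveFrame.lean`
(p134611, LANDED: `oddContactSymmetry_iff_pinned`, `oddContactSymmetry_iff_smoothKinematics` — import that module, not this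
work file), A's `RungZeroFrame.lean` (p134598, LANDED) and `MetropolisMixture.lean` (p134531, LANDED), and the re-threaded
`RefutationNeedsFlows.lean` (p134458, LANDED).)

### What the rev-5 insertions are worth — structural audit (no junk found)
* `IsHardSphereEulerSolution σ T ρ u θ` asks joint `C^∞` smoothness on `Ico 0 T ×ˢ univ` — CLOSED at `t = 0` — so the
  time-`0` slices are genuine data: continuous (`continuous_slices_zero`) and smooth (`IsSmoothSpaceTimeOn.isSmooth_slice`)
  as soon as `T > 0`, which `0 < τ < T` forces.  `T ≤ 0` makes the body vacuous (harmless); `T` cannot be junk-enlarged past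
  the classical lifespan because the slices are pinned (next item) and classical solutions are unique.
* THE TIE IS DATA PINNING AND NOTHING ELSE (`oddContactSymmetry_iff_pinned`, §10.2): below the statics threshold
  `σ₁(a₀, θ₀, u₀) ≤ 1/2` of the landed `PolynomialCompressionPDE.lln_rhoLim` (local Gibbs laws are probability measures, the
  `t = 0` fields converge through EVERY flow family to `(rhoLim (profileOf a₀) σ, u₀, θ₀)`), the tie through the given `Φ`
  holds iff `ρ 0 = rhoLim (profileOf a₀) σ ∧ u 0 = u₀ ∧ θ 0 = θ₀` (`tendstoHydroFieldsAt_zero_iff_flowFree`,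
  `data_eq_of_flowFree`: uniqueness of limits in probability).  So the crux is EQUIVALENT to its particle-free-hypothesis
  form `OddContactSymmetryPinned`: the prover may forget the LLN bookkeeping at `t = 0`; a refuter has no freedom in
  `(ρ, u, θ)` beyond the profiles.
* CONTINUITY-ONLY PROFILES ARE DECORATION (`oddContactSymmetry_iff_smoothKinematics`, §10.3): pinned `u 0 = u₀`,
  `θ 0 = θ₀` are slices of jointly smooth fields, so at every profile triple with non-smooth `u₀` or `θ₀` the hypotheses are
  contradictory and the crux holds vacuously; the crux equals its restriction to `Torus.IsSmooth u₀ ∧ Torus.IsSmooth θ₀`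
  (and, informally, smooth `a₀`, through `ρ 0 = rhoLim (profileOf a₀) σ`).
* AT CONSTANT PROFILES THE FRAME IS VOID (A's `RungZeroFrame.lean`): constant states are classical solutions on every
  `[0, T)` and the tie is the identified homogeneous LLN, so the crux still contains the ALL-HORIZON equilibrium statement —
  "before the first shock" fences only the §3 wild-limit mechanism off equilibrium, exactly as designed (§5).

### Cheap attacks re-run on the rev-5 text (all survive; numbers inherited from §7/§8 and the rattack MC)
* velocity holes: `e^{−F}` carries the CURRENT (post-collisional, self-spiked) velocities in the numerator and the reflected
  pre-velocities (no particle there) in the denominator, so holes make `e^{−F}` LARGE and `min 1 ·` clips them: weight `≤ 1`,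
  `|D| ≤ ‖χ g Ψ‖_∞ K_N[1]` pathwise — §7 is dead by construction (`le_min_of_parityExact_le_one`);
* r-ball mixtures: the Metropolis residual against a chaotic pair law is `a (b′ − b)/max(b, b′)` (`metropolis_residual`), non-zero
  at fixed `r` on the §3 witness (A's `not_metropolisBalance_for_mixtures`), size `σ³·O((r∇θ/θ)²)` before shocks (rattack MC:
  `κ = .05/.1/.2/.4 ↦ −3.6e-4/−1.4e-3/−5.5e-3/−2.0e-2`) — absorbed by the filed order `∀ η δ, ∃ r₀(η, δ)`; it kills only the
  `r₀`-before-`η` strengthening;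
* the kink of `min 1 ·` at `F = 0`: the residual `sign(F̄)(1 − e^{−|F̄|})` is ODD in the KDE log-error `F̄`, so symmetric KDE
  noise gives no first-order bias; the systematic part of `E[F | q]` (curvature of `log`, `≈ −½ Σ ±1/n_eff(·)` over the four
  query points) is `O(1/(N r³ ϑ³ M))`, J-odd, and `→ 0` as `N → ∞` at fixed `(r, ϑ)` — the `O(0.01–0.15)` equilibrium offsets of
  the bounded statistics at `N ≤ 2.2·10⁴` (j013997) are this finite-`N` term, decaying;
* `t = 0` layer: the local Gibbs contact law is J-even for ALL profiles (product of local Maxwellians at one point, up to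
  `O(ε∇)`), so any J-odd contact correlation must be BUILT dynamically within `O(1)` macroscopic time = `O(N^{1/3})` mean free
  times from J-even data; the first-order (Chapman–Enskog / ring) response is `O(Kn) + O(σ³ Kn)` and measured `0.15–0.2·Kn`.
* junk sweep of the new symbols: `TendstoHydroFieldsAt` is three `Tendsto … (𝓝 0)` of measures of strict super-level sets
  (no division, no `toReal`); `localGibbsLaw` is a probability measure for `σ ≤ 1/2` (`isProbabilityMeasure_localGibbsLaw`) and
  `≪ liouville`, so `Φ.flow 0 = id` a.s.; `IsHardSphereEulerSolution` has no junk operators (torus calculus within `Ico 0 T`).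

### What a witness must look like now (necessary conditions, all proved above or inherited)
smooth pinned data `(rhoLim (profileOf a₀) σ, u₀, θ₀)`; a horizon `τ` below the classical lifespan of THAT solution; Alexander
flows (free, `nonempty_torus_holds`); and an `O(1)`-per-collision J-odd pre-collisional contact correlation built dynamically
from J-even `t = 0` data in `O(1)` macroscopic time at arbitrarily small reduced density `σ³` — i.e. a failure of local
equilibrium at the kinetic scale BEFORE any shock, visible in the odd channel.  No mechanism for this is known in print or
numerics (grounders g71-*, planner rev-5 novelty log; EDMD j013997: odd signal `O(Kn)`, no plateau); it is the intended open
content of the crux, and a kernel `¬S` additionally needs the law of the collision process of the `N`-sphere flow (§1/§8.1).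
Literature re-check this session DEGRADED (searchd connection reset, OpenAlex 429, arXiv 0 rows) — nothing new over the grounders'
rev-5 sweep (g71-*, 2026-08-16).  VERDICT (cycle 1, instance B): RESISTS; no kill; four Negative files landed between the two
instances (RevFiveFrame p134611, RungZeroFrame p134598, MetropolisMixture p134531, RefutationNeedsFlows p134458).
-/

/-! ### §10.1  The statistic's tail, and the crux unfolded -/

/-- The crux's body from `∀ χ` on — the Metropolis-weighted J-odd collision statistic `D` and the claim
`localGibbsLaw {η < |D|} ≤ δ` for `N ≥ N₀(r, ϑ)`, `r, ϑ < r₀(η, δ)` — as a function of the threshold `η₀`, the reduced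
density `σ`, the local-Gibbs profiles, the flow family and the horizon `τ`.  VERBATIM the text of
`JParityClosure.OddContactSymmetry` (stmt-AtomisticToContinuum-17722). -/
def OddStatTail (η₀ σ : ℝ) (a₀ : T3 → ℝ) (u₀ : T3 → V3) (θ₀ : T3 → ℝ) (Φ : Flows σ) (τ : ℝ) : Prop :=
  ∀ χ : ℝ × UnitAddTorus (Fin 3) → ℝ, Continuous χ → ∀ g : ℝ → ℝ, Continuous g → (∀ a, η₀ ≤ a → g a = 0) → ∀ Ψ : EuclideanSpace ℝ (Fin 3) × EuclideanSpace ℝ (Fin 3) × EuclideanSpace ℝ (Fin 3) → ℝ, Continuous Ψ → (∃ C : ℝ, ∀ q, |Ψ q| ≤ C) → (∀ (n v w : EuclideanSpace ℝ (Fin 3)), ‖n‖ = 1 → Ψ (-n, (Literature.Analysis.FluidPDE.reflectVel n (v, w)).1, (Literature.Analysis.FluidPDE.reflectVel n (v, w)).2) = -Ψ (n, v, w)) → ∀ η δ : ℝ, 0 < η → 0 < δ → ∃ r₀ : ℝ, 0 < r₀ ∧ ∀ r ϑ : ℝ, 0 < r → r < r₀ → 0 < ϑ → ϑ < r₀ →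 ∃ N₀ : ℕ, ∀ N : ℕ, N₀ ≤ N → let ε := Literature.MathematicalPhysics.KineticTheory.hsDiameter σ N; let G := Literature.Analysis.FluidPDE.Torus.geometry (Fin 3); let γ := fun z (s : ℝ) => (Φ N).flow s z; let bx : UnitAddTorus (Fin 3) → UnitAddTorus (Fin 3) → ℝ := fun x y => 3 / (Real.pi * r ^ 3) * max (1 - Literature.Analysis.FluidPDE.Torus.euclidDist x y / r) 0; let ρm := fun z s (x₀ : UnitAddTorus (Fin 3)) => ∫ q, bx q.1 x₀ ∂(Literature.Analysis.FluidPDE.empiricalMeasure (γ z s)); let hm := fun z s (x₀ : UnitAddTorus (Fin 3)) (v : EuclideanSpace ℝ (Fin 3)) => ∫ q, bx q.1 x₀ * Literature.Analysis.FluidPDE.localMaxwellian 1 (ϑ ^ 2) v q.2 ∂(Literature.Analysis.FluidPDE.empiricalMeasure (γ z s)); let pv := fun z s (i j : Fin (N + 1)) => Literature.Analysis.FluidPDE.reflectVel (G.sepVec (γ z s i).1 (γ z s j).1) ((γ z s i).2, (γ z s j).2); let F := fun z s (i j : Fin (N + 1)) => Real.log (hm z s (γ z s i).1 (pv z s i j).1)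 + Real.log (hm z s (γ z s i).1 (pv z s i j).2) - Real.log (hm z s (γ z s i).1 (γ z s i).2) - Real.log (hm z s (γ z s i).1 (γ z s j).2); let Kc := fun (Fn : Literature.Analysis.FluidPDE.Config (N + 1) (Fin 3) Literature.MathematicalPhysics.KineticTheory.T3 → ℝ → Fin (N + 1) → Fin (N + 1) → ℝ) z => ε / (N + 1 : ℝ) * ∑ᶠ (s : ℝ) (_ : s ∈ Literature.Analysis.FluidPDE.collisionTimes G ε (γ z) ∩ Set.Icc 0 τ), ∑ i : Fin (N + 1), ∑ j : Fin (N + 1), (if i ≠ j ∧ ‖G.sepVec (γ z s i).1 (γ z s j).1‖ = ε then Fn z s i j else 0); let D := fun z => Kc (fun z s i j => χ (s, (γ z s i).1) * g (σ ^ 3 * ρm z s (γ z s i).1) * (Ψ (ε⁻¹ • G.sepVec (γ z s i).1 (γ z s j).1, (pv z s i j).1, (pv z s i j).2) * min 1 (Real.exp (-F z s i j)))) z; Literature.MathematicalPhysics.KineticTheory.localGibbsLaw σ a₀ u₀ θ₀ N (Φ N) {z | η < |D z|} ≤ ENNReal.ofReal δ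

/-- The crux, unfolded down to its tail (definitional). [folklore] -/
theorem oddContactSymmetry_iff_tail :
    OddContactSymmetry ↔ ∃ η₀ : ℝ, 0 < η₀ ∧ ∀ (a₀ θ₀ : T3 → ℝ) (u₀ : T3 → V3), Continuous a₀ → Continuous θ₀ →
      Continuous u₀ → (∀ x, 0 < a₀ x) → (∀ x, 0 < θ₀ x) → ∃ σ₀ : ℝ, 0 < σ₀ ∧ ∀ σ : ℝ, 0 < σ → σ < σ₀ →
      ∀ (T : ℝ) (ρ θ : ℝ → T3 → ℝ) (u : ℝ → T3 → V3), IsHardSphereEulerSolution σ T ρ u θ →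
      ∀ Φ : Flows σ, TendstoHydroFieldsAt (fun N => localGibbsLaw σ a₀ u₀ θ₀ N (Φ N)) Φ ρ u θ 0 →
      ∀ τ : ℝ, 0 < τ → τ < T → OddStatTail η₀ σ a₀ u₀ θ₀ Φ τ :=
  Iff.rfl

/-! ### §10.2  The tie is data pinning -/

/-- **`OddContactSymmetry` with the probabilistic `t = 0` tie replaced by PINNED DATA**: the classical solution has
`ρ 0 = rhoLim (profileOf a₀) σ`, `u 0 = u₀`, `θ 0 = θ₀`; no law of large numbers, no flow in the hypotheses on
`(ρ, u, θ)`.  Equivalent to the crux (`oddContactSymmetry_iff_pinned`). -/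
def OddContactSymmetryPinned : Prop :=
  ∃ η₀ : ℝ, 0 < η₀ ∧ ∀ (a₀ θ₀ : T3 → ℝ) (u₀ : T3 → V3) (ha : Continuous a₀), Continuous θ₀ →
    Continuous u₀ → ∀ (ha0 : ∀ x, 0 < a₀ x), (∀ x, 0 < θ₀ x) → ∃ σ₀ : ℝ, 0 < σ₀ ∧ ∀ σ : ℝ, 0 < σ → σ < σ₀ →
    ∀ (T : ℝ) (ρ θ : ℝ → T3 → ℝ) (u : ℝ → T3 → V3), IsHardSphereEulerSolution σ T ρ u θ →
    ρ 0 = rhoLim (profileOf a₀ ha ha0) σ → u 0 = u₀ → θ 0 = θ₀ →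
    ∀ Φ : Flows σ, ∀ τ : ℝ, 0 < τ → τ < T → OddStatTail η₀ σ a₀ u₀ θ₀ Φ τ

/-- **The tie is data pinning and nothing else**: `OddContactSymmetry ↔ OddContactSymmetryPinned`.  Both directions
shrink `σ₀` below the statics threshold `σ₁(a₀, θ₀, u₀) ≤ 1/2` of `lln_rhoLim`; `T > 0` from `0 < τ < T` makes the
time-`0` slices continuous (`continuous_slices_zero`), and then the tie through the given flow family holds iff the
slices are `(rhoLim (profileOf a₀) σ, u₀, θ₀)` (`tendstoHydroFieldsAt_zero_iff_flowFree`, `data_eq_of_flowFree`).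
[folklore] -/
theorem oddContactSymmetry_iff_pinned : OddContactSymmetry ↔ OddContactSymmetryPinned := by
  constructor
  · rintro ⟨η₀, hη₀, H⟩
    refine ⟨η₀, hη₀, fun a₀ θ₀ u₀ ha hθ hu ha0 hθ0 => ?_⟩
    obtain ⟨σ₀, hσ₀, Hσ⟩ := H a₀ θ₀ u₀ ha hθ hu ha0 hθ0
    obtain ⟨σ₁, hσ₁, -, G⟩ := lln_rhoLim (u₀ := u₀) ha hθ hu ha0 hθ0
    refine ⟨min σ₀ σ₁, lt_min hσ₀ hσ₁, fun σ hσ hσlt T ρ θ u hE h1 h2 h3 Φ τ hτ hτT => ?_⟩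
    have hσ0' : σ < σ₀ := lt_of_lt_of_le hσlt (min_le_left _ _)
    have hσ1' : σ < σ₁ := lt_of_lt_of_le hσlt (min_le_right _ _)
    obtain ⟨-, -, Gσ⟩ := G σ hσ hσ1'
    have htie : TendstoHydroFieldsAt (fun N => localGibbsLaw σ a₀ u₀ θ₀ N (Φ N)) Φ ρ u θ 0 := by
      refine (tendstoHydroFieldsAt_zero_iff_flowFree Φ).2 ?_
      rw [h1, h2, h3]
      -- no expected type on the next line: `(fun _ => c) 0` must beta-reduce on instantiation (cf. `admissible_iff_data`)
      have hff := (tendstoHydroFieldsAt_zero_iff_flowFree Φ).1 (Gσ Φ).2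
      exact hff
    exact Hσ σ hσ hσ0' T ρ θ u hE Φ htie τ hτ hτT
  · rintro ⟨η₀, hη₀, H⟩
    refine ⟨η₀, hη₀, fun a₀ θ₀ u₀ ha hθ hu ha0 hθ0 => ?_⟩
    obtain ⟨σ₀, hσ₀, Hσ⟩ := H a₀ θ₀ u₀ ha hθ hu ha0 hθ0
    obtain ⟨σ₁, hσ₁, hσ₁2, G⟩ := lln_rhoLim (u₀ := u₀) ha hθ hu ha0 hθ0
    refine ⟨min σ₀ σ₁, lt_min hσ₀ hσ₁, fun σ hσ hσlt T ρ θ u hE Φ htie τ hτ hτT => ?_⟩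
    have hσ0' : σ < σ₀ := lt_of_lt_of_le hσlt (min_le_left _ _)
    have hσ1' : σ < σ₁ := lt_of_lt_of_le hσlt (min_le_right _ _)
    have hσ2 : σ ≤ 1 / 2 := (hσ1'.trans_le hσ₁2).le
    obtain ⟨h, hpos, Gσ⟩ := G σ hσ hσ1'
    obtain ⟨hρc, huc, hθc⟩ := continuous_slices_zero hE (hτ.trans hτT)
    have hlln := (tendstoHydroFieldsAt_zero_iff_flowFree Φ).1 (Gσ Φ).2
    have ht := (tendstoHydroFieldsAt_zero_iff_flowFree Φ).1 htie
    obtain ⟨h1, h2, h3⟩ := data_eq_of_flowFree ha hθ hu ha0 hθ0 hσ2 h.continuous_rhoLim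
      (fun x => h.rhoLim_pos (hpos x)) hlln hρc huc hθc ht
    exact Hσ σ hσ hσ0' T ρ θ u hE h1 h2 h3 Φ τ hτ hτT

/-! ### §10.3  Continuity-only profiles are decoration -/

/-- **`OddContactSymmetry` restricted to SMOOTH kinematic profiles**: verbatim the crux with the two extra hypotheses
`Torus.IsSmooth u₀`, `Torus.IsSmooth θ₀`.  Equivalent to the crux (`oddContactSymmetry_iff_smoothKinematics`).
-/
def OddContactSymmetrySmoothKinematics : Prop :=
  ∃ η₀ : ℝ, 0 < η₀ ∧ ∀ (a₀ θ₀ : T3 → ℝ) (u₀ : T3 → V3), Continuous a₀ → Continuous θ₀ →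
    Continuous u₀ → (∀ x, 0 < a₀ x) → (∀ x, 0 < θ₀ x) → Torus.IsSmooth u₀ → Torus.IsSmooth θ₀ →
    ∃ σ₀ : ℝ, 0 < σ₀ ∧ ∀ σ : ℝ, 0 < σ → σ < σ₀ →
    ∀ (T : ℝ) (ρ θ : ℝ → T3 → ℝ) (u : ℝ → T3 → V3), IsHardSphereEulerSolution σ T ρ u θ →
    ∀ Φ : Flows σ, TendstoHydroFieldsAt (fun N => localGibbsLaw σ a₀ u₀ θ₀ N (Φ N)) Φ ρ u θ 0 →
    ∀ τ : ℝ, 0 < τ → τ < T → OddStatTail η₀ σ a₀ u₀ θ₀ Φ τ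

/-- **Continuity-only profiles are decoration**: `OddContactSymmetry ↔ OddContactSymmetrySmoothKinematics`.  For
profiles with non-smooth `u₀` or `θ₀` the crux's hypotheses are contradictory below the statics threshold: the tie
pins `u 0 = u₀`, `θ 0 = θ₀` (`data_eq_of_flowFree`), `0 < τ < T` gives `T > 0`, and time-`0` slices of a classical
solution are smooth (`IsSmoothSpaceTimeOn.isSmooth_slice`). [folklore] -/
theorem oddContactSymmetry_iff_smoothKinematics : OddContactSymmetry ↔ OddContactSymmetrySmoothKinematics := by
  constructor
  · rintro ⟨η₀, hη₀, H⟩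
    exact ⟨η₀, hη₀, fun a₀ θ₀ u₀ ha hθ hu ha0 hθ0 _ _ => H a₀ θ₀ u₀ ha hθ hu ha0 hθ0⟩
  · rintro ⟨η₀, hη₀, H⟩
    refine ⟨η₀, hη₀, fun a₀ θ₀ u₀ ha hθ hu ha0 hθ0 => ?_⟩
    obtain ⟨σ₁, hσ₁, hσ₁2, G⟩ := lln_rhoLim (u₀ := u₀) ha hθ hu ha0 hθ0
    by_cases hsm : Torus.IsSmooth u₀ ∧ Torus.IsSmooth θ₀
    · obtain ⟨σ₀, hσ₀, Hσ⟩ := H a₀ θ₀ u₀ ha hθ hu ha0 hθ0 hsm.1 hsm.2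
      exact ⟨σ₀, hσ₀, Hσ⟩
    · refine ⟨σ₁, hσ₁, fun σ hσ hσlt T ρ θ u hE Φ htie τ hτ hτT => ?_⟩
      exfalso
      have hT : 0 < T := hτ.trans hτT
      have hσ2 : σ ≤ 1 / 2 := (hσlt.trans_le hσ₁2).le
      obtain ⟨h, hpos, Gσ⟩ := G σ hσ hσlt
      obtain ⟨hρc, huc, hθc⟩ := continuous_slices_zero hE hT
      have hlln := (tendstoHydroFieldsAt_zero_iff_flowFree Φ).1 (Gσ Φ).2
      have ht := (tendstoHydroFieldsAt_zero_iff_flowFree Φ).1 htie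
      obtain ⟨-, h2, h3⟩ := data_eq_of_flowFree ha hθ hu ha0 hθ0 hσ2 h.continuous_rhoLim
        (fun x => h.rhoLim_pos (hpos x)) hlln hρc huc hθc ht
      have h0 : (0 : ℝ) ∈ Ico 0 T := ⟨le_rfl, hT⟩
      have hus : Torus.IsSmooth (u 0) := hE.smooth_velocity.isSmooth_slice h0
      have hθs : Torus.IsSmooth (θ 0) := hE.smooth_temperature.isSmooth_slice h0
      rw [h2] at hus
      rw [h3] at hθs
      exact hsm ⟨hus, hθs⟩


end RevFiveInstanceB


/-! ## §9  Rev 5 (item stmt-AtomisticToContinuum-17722; seat `refuter-cdisprove-stmt-AtomisticToContinuum-17722-0`, cycle 1, 2026-08-17):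
## audit of the RESTATED crux — Metropolis weight + pre-shock frame

### §9.1  Read-back of the restatement (token diff 13078 → 17722 = exactly four edits; everything else byte-identical)

(1) `∀ (T : ℝ) (ρ θ : ℝ → T3 → ℝ) (u : ℝ → T3 → V3), IsHardSphereEulerSolution σ T ρ u θ →` — a classical (jointly `C^∞`
on `Ico 0 T`) hard-sphere-Euler solution; for `T ≤ 0` the structure is vacuous but then (3) empties the `τ`-range, so no
junk solution is exploitable.  (2) `TendstoHydroFieldsAt (fun N => localGibbsLaw σ a₀ u₀ θ₀ N (Φ N)) Φ ρ u θ 0 →` — the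
`t = 0` LLN tie; since the local Gibbs laws are probability measures for small `σ` and limits in probability are unique, it
PINS `(ρ, u, θ)(0) = (rhoLim[a₀, σ], u₀, θ₀)`: the refuter does not get to choose the Euler data, only the profiles.
Off equilibrium a Lean refuter therefore owes, besides the dynamics, the SMOOTHNESS of the activity-to-density map and a
classical solution issued from that data — except where the tree already has both (§9.2: constants, stationary shear).
(3) `τ < T` — the shock clock.  (4) the weight `(1 + Real.exp (-F …))` ↦ `min 1 (Real.exp (-F …))`.
Orientation of `F` (unchanged, but it decides what `min` does): `F = log hm(pv.1) + log hm(pv.2) − log hm(v_i(s)) − log hm(v_j(s))`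
with `pv = reflectVel (sepVec x_i x_j) (v_i(s), v_j(s))`; the tree's trajectories are right-continuous, so `(v_i(s), v_j(s))`
are the POST-collisional (current) velocities — atoms of the current empirical measure, each carrying its self-spike
`s₀ = (3/πr³)(2πϑ²)^{−3/2}/(N+1)` in `hm` — and `pv` are the PRE-collisional ones, atoms of nothing.  Hence
`e^{−F} = hm(v⁺)hm(w⁺)/(hm(v⁻)hm(w⁻))` (informal text: `min(1,e^{−F}) = min(hh_*, h′h′_*)/hh_*`, `h = h(v⁻)`): a velocity-HOLE
collision (fast pre-particle isolated from its `r`-ball cloud, §7/§8.1) has a tiny DENOMINATOR, `e^{−F} → +∞`, and is now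
weighted by exactly `1` — the blow-up is clipped, nothing else; the weight is `< 1` precisely on collisions whose PRE-region
of the KDE is denser than their POST-region (`hh_* > h′h′_*`: "entropy-lowering" collisions relative to the mollified law).
`reflectVel` normalises by `‖n‖²` and `reflectVel (−n) = reflectVel n`, so `pv` does not depend on the orientation convention
of `sepVec`; the first argument `ε⁻¹ • sepVec x_i x_j` of `Ψ` is a unit vector on the contact branch, and both ordered pairs
are summed, so the convention only relabels `(i,j) ↔ (j,i)`.  Junk audit (re-run on the rev-5 text): `hm > 0` (self term) so
all four logs are honest; `finsum` over `collisionTimes ∩ Icc 0 τ` is a finite sum on `Φ.good` (law-conull) and `0` off it;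
`bx` is normalised (`∫(1−|y|/r)₊ dy = πr³/3`) and torus-honest for `r < 1/2` (the prover's `r₀`); `ENNReal.ofReal δ` with
`δ > 0`; the event may be non-measurable (outer measure, harmless for `≤`).  Quantifier order unchanged:
`∃η₀ ∀profiles ∃σ₀ ∀σ ∀(T,ρ,θ,u) ∀Φ ∀τ ∀χ ∀g ∀Ψ ∀η δ ∃r₀ ∀r ϑ ∃N₀ ∀N` — `N → ∞` at FIXED `(r, ϑ)`, then `r, ϑ → 0` only
through `r₀(η, δ)`.

### §9.2  The frame is void at rung 0 and along the stationary shear; the sandwich (theorems below)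

`OddContactSymmetryMinAllTimes → OddContactSymmetry → OddStatRungZeroAllTimes ∧ OddStatShearAllTimes`
(`oddContactSymmetryMinAllTimes_imp`, `oddContactSymmetry_imp_rungZeroAllTimes`, `oddContactSymmetry_imp_shearAllTimes`;
the last two landed as `Negative/RungZeroFrame.lean`, `Negative/ShearFrame.lean`).  Upward: the frame-free Metropolis
statement (card metropolis-min-weight's C′₃, all horizons) implies the crux — provers may prove the stronger frame-free form
wherever convenient (rung 0, rung ½).  Downward: at the homogeneous state `(1, 0, θ₀)` and along the isothermal shear
`(1, sin(2π x₁)e₀, 1)` the three rev-5 hypotheses are discharged in tree for EVERY `T` (`isHardSphereEulerSolution_const`,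
`homogeneous_lln_identified`; `isHardSphereEulerSolution_shear`, `shear_tied`), so the crux claims the Metropolis odd statistic
`→ 0` for EVERY horizon `τ` there — the frame restricts nothing where every cheap attack and every MD run lives.  The shear
member is the first FRAME-FREE NON-EQUILIBRIUM statement inside the crux: its incoming contact law is J-odd at order `Kn`
(Chapman–Enskog), the crux bets all of it dies as `Kn ≍ (N+1)^{−1/3} → 0` at fixed `τ` (viscous decay / shear instability of
the profile act on times `≳ log N`, invisible at fixed `τ`, so the frame-free form is exactly as plausible as the framed one).

### §9.3  The Metropolis weight keeps the mixture obstruction (theorems below; landed `Negative/MetropolisMixture.lean`)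

`min` is parity-exact (`parityExact_min`), its pair residual is `(ab′ − a′b)/max(b,b′)` (`metropolis_residual`), so at FIXED
`(r,ϑ)` the limit content is twisted balance, false for a two-temperature mollified law against a perfectly chaotic
one-temperature pair law (`metropolis_residual_ne_zero_of_mixture`, `not_metropolisBalance_for_mixtures`, from §3's witness).
Size: bounded by `1` now (no blow-up), `σ³·O((r∇θ/θ)²)` for smooth profiles (refuter-rattack MC on the item:
`κ = .05/.1/.2/.4 ↦ −3.6e-4/−1.4e-3/−5.5e-3/−2.0e-2`), `O(1)` only on `O(1)`-volume sub-`r` structure (§3, post-shock — excluded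
by the frame).  So: `r₀` MUST shrink with `η`; a line whose transfer stub fixes `r` independently of `η` is dead on arrival.

### §9.4  Finite-`N` anatomy of the Metropolis statistic at rung 0 (what the MD biases are)

At exact twisted balance of the continuum law (`h(q₁)h(q₂) = h(p₁)h(p₂)` for post `q`, pre `p` — rung 0 in the limit, §4) the
self-spikes of the two CURRENT velocities sit in the numerator of `e^{−F}`, so they can only RAISE it: the spiked Metropolis
weight is exactly `1` on both members of a `J`-pair (`spiked_metropolis_weight_eq_one`) — self-spikes produce NO odd bias at
balance (contrast §7: with `1 + e^{−F}` they were the blow-up).  What remains at finite `N` is (i) the KDE FLUCTUATION of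
`log R` over the `n_b ≈ (N+1)(4π/3)r³ρ` ball samples, relative size `(n_b ϑ³)^{−1/2}` per bulk query (`≈ 0.2` at `N = 2.2·10⁴,
r = 0.2, ϑ = 0.3`, matching the O(0.01–0.15) equilibrium biases of the bounded variants in j013997), symmetric to first order
and vanishing as `N → ∞` at fixed `(r,ϑ)`; (ii) the clipped hole band of §8.1, a fraction `≈ N^{−1−a}` of the collisions, each
now weighing `≤ ε/(N+1)·‖Ψ‖∞`; (iii) the `O(ε/r)` reading-point offset between the twins `(i,j)`, `(j,i)`; (iv) the honest
`O(Kn)` Chapman–Enskog odd signal off equilibrium.  None has a floor.  For MD this means: subtract the equilibrium null at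
EQUAL `(N, r, ϑ)` and demand `N r³ϑ³ ≫ 10²` before reading a plateau.

### §9.5  Why it resists (cycle-1 verdict), what a kernel `¬S` owes after rev 5, re-arm plan

* No junk, no vacuity, no degenerate parameter bites (§9.1; rattack's one-shot audit independently concurs).  Dropping
  hypotheses: J-oddness of `Ψ` (load-bearing: `Ψ ≡ 1` gives `K_N[χ g min(1,e^{−F})] → K̄ > 0` by any rate floor — dynamics,
  prose); boundedness/continuity of `Ψ` (tightness/weak-limit bookkeeping only); the frame (NOT load-bearing at rung 0 / rung ½,
  §9.2; load-bearing only against §3's post-shock wild limits); `min` (load-bearing: without it rev 1–4, false at rung 0, §7);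
  the order `∃ r₀(η)` (load-bearing, §9.3); `N → ∞` before `r, ϑ → 0` (load-bearing: KDE consistency needs `N r³ϑ³ → ∞`).
* A kernel `¬ OddContactSymmetry` after rev 5 = (flows: Alexander, in tree) + (frame: free at rung 0 / shear, §9.2) + the LAW of
  the collision point process along the flow over a fixed macroscopic horizon (`≍ N^{1/3}` mean free times): a two-time
  statement beyond Lanford windows (BodineauEtAl2023 is Boltzmann–Grad, short times) — not in tree, not in print.  And the
  physics it would have to exhibit is an `O(1)` J-odd incoming contact correlation surviving `Kn → 0` before any shock ("fake
  equilibrium"): no mechanism known; the two perturbative sources (Chapman–Enskog `O(Kn)`, rings `O(φ·Kn)`) are measured and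
  decay (j013997).  Barrier catalogue (`Literature/Barriers/AtomisticToContinuum/`): BoltzmannHypothesis / VelocityReversal /
  NoDensityExpansion do not bite a bounded forward-in-time collision statistic (unchanged from the route's BARRIERS audit).
* Re-arm plan: (a) the batched MD job of ## Compute aimed at `OddStatShearAllTimes`; (b) the lead's stubs as `-- Targets`
  (first check: does a transfer stub use the frame at rung 0/½, or fix `r` before `η`? both are misstatements by §9.2/§9.3);
  (c) if an ideator's line needs the UNWEIGHTED odd statistic, note `mixture_of_balanced_is_balanced` (§2b): it is immune to
  §9.3 and is the cleaner numerical observable.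
-/

/-- **Self-spikes never lower the Metropolis weight at balance (§9.4).**  If the continuum law is twisted-balanced on a
collision (`x·y = B`, `x, y` the mollified densities at the two CURRENT velocities, `B` the product at the two reflected ones)
then adding the non-negative self-spikes `s, t` to the current-velocity queries gives weight `min 1 ((x+s)(y+t)/B) = 1`.
[folklore] -/
theorem spiked_metropolis_weight_eq_one {x y s t B : ℝ} (hx : 0 < x) (hy : 0 < y) (hs : 0 ≤ s) (ht : 0 ≤ t)
    (hB : x * y = B) : min 1 ((x + s) * (y + t) / B) = 1 := by
  have hBpos : 0 < B := hB ▸ mul_pos hx hy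
  refine min_eq_left ((one_le_div hBpos).2 ?_)
  rw [← hB]
  nlinarith [mul_nonneg hs ht, mul_nonneg hx.le ht, mul_nonneg hs hy.le]

/-- **The Metropolis residual of a chaotic pair law against a two-temperature mollified law is non-zero on the witness
collision (§9.3)** — landed as `OddContactSymmetryNegative.metropolis_residual_ne_zero_of_mixture`. [folklore] -/
theorem metropolis_residual_ne_zero_of_mixture {θ₁ θ₂ c a : ℝ} (h₁ : 0 < θ₁) (h₂ : 0 < θ₂) (hne : θ₁ ≠ θ₂)
    (hc : c ≠ 0) (ha : 0 < a) (v w v' w' : V3)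
    (hv : ‖v‖ ^ 2 = 2 * c) (hw : ‖w‖ ^ 2 = 0) (hv' : ‖v'‖ ^ 2 = c) (hw' : ‖w'‖ ^ 2 = c) :
    let h : V3 → ℝ := fun u => localMaxwellian 1 θ₁ (0 : V3) u + localMaxwellian 1 θ₂ (0 : V3) u
    a * min 1 (h v' * h w' / (h v * h w)) - a * min 1 (h v * h w / (h v' * h w')) ≠ 0 := by
  intro h
  have hpos : ∀ u, 0 < h u := fun u =>
    add_pos (localMaxwellian_pos one_pos h₁ (0 : V3) u) (localMaxwellian_pos one_pos h₂ (0 : V3) u)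
  have hb : 0 < h v * h w := mul_pos (hpos v) (hpos w)
  have hb' : 0 < h v' * h w' := mul_pos (hpos v') (hpos w')
  have hlt : h v' * h w' < h v * h w :=
    mixture_mollifier_breaks_twisted_balance h₁ h₂ hne hc v w v' w' hv hw hv' hw'
  rw [Theorems.OddContactSymmetryNegative.metropolis_residual a a hb hb']
  have hnum : a * (h v' * h w') - a * (h v * h w) < 0 := by nlinarith
  have hden : 0 < max (h v * h w) (h v' * h w') := lt_max_of_lt_left hb
  exact (div_neg_of_neg_of_pos hnum hden).ne

/-- **Refuted strengthening (rev 5, §9.3): Metropolis twisted balance fails at fixed mollification scale** — landed as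
`OddContactSymmetryNegative.not_metropolisBalance_for_mixtures`.  `θ₁ = 1, θ₂ = 2`, `a = 1`, `n = −e₀`, `v = e₀ + e₁`,
`w = 0`. [folklore] -/
theorem not_metropolisBalance_for_mixtures :
    ¬ (∀ θ₁ θ₂ : ℝ, 0 < θ₁ → 0 < θ₂ → ∀ a : ℝ, 0 < a → ∀ n v w : V3,
        let h : V3 → ℝ := fun u => localMaxwellian 1 θ₁ (0 : V3) u + localMaxwellian 1 θ₂ (0 : V3) u
        a * min 1 (h (reflectVel n (v, w)).1 * h (reflectVel n (v, w)).2 / (h v * h w)) -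
            a * min 1 (h v * h w / (h (reflectVel n (v, w)).1 * h (reflectVel n (v, w)).2)) = 0) := by
  intro H
  obtain ⟨_, _, hrefl, hv, hw, h1, h0⟩ := mixture_witness_geometry
  set e₀ : V3 := EuclideanSpace.single (0 : Fin 3) (1 : ℝ)
  set e₁ : V3 := EuclideanSpace.single (1 : Fin 3) (1 : ℝ)
  have heq := H 1 2 one_pos two_pos 1 one_pos (-e₀) (e₀ + e₁) 0
  simp only [hrefl] at heq
  exact metropolis_residual_ne_zero_of_mixture (θ₁ := 1) (θ₂ := 2) one_pos two_pos (by norm_num)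
    (c := 1) one_ne_zero one_pos (e₀ + e₁) 0 e₁ e₀ hv hw h1 h0 heq

/-- **C′₃ frame-free (card metropolis-min-weight's statement, all horizons)**: the rev-5 crux with the three frame
insertions (classical solution, `t = 0` LLN, `τ < T`) deleted and everything else verbatim.  The strongest member of the
sandwich of §9.2. -/
def OddContactSymmetryMinAllTimes : Prop :=
  ∃ η₀ : ℝ, 0 < η₀ ∧ ∀ (a₀ θ₀ : Literature.MathematicalPhysics.KineticTheory.T3 → ℝ) (u₀ : Literature.MathematicalPhysics.KineticTheory.T3 → Literature.MathematicalPhysics.KineticTheory.V3), Continuous a₀ → Continuous θ₀ → Continuous u₀ → (∀ x, 0 < a₀ x) → (∀ x, 0 < θ₀ x) → ∃ σ₀ : ℝ, 0 < σ₀ ∧ ∀ σ : ℝ, 0 < σ → σ < σ₀ → ∀ Φ : (N : ℕ) → Literature.Analysis.FluidPDE.HardSphereFlow (Literature.Analysis.FluidPDE.Torus.geometry (Fin 3)) (Literature.MathematicalPhysics.KineticTheory.hsDiameter σ N) (N + 1), ∀ τ : ℝ, 0 < τ → ∀ χ : ℝ × UnitAddTorus (Fin 3) → ℝ, Continuous χ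 → ∀ g : ℝ → ℝ, Continuous g → (∀ a, η₀ ≤ a → g a = 0) → ∀ Ψ : EuclideanSpace ℝ (Fin 3) × EuclideanSpace ℝ (Fin 3) × EuclideanSpace ℝ (Fin 3) → ℝ, Continuous Ψ → (∃ C : ℝ, ∀ q, |Ψ q| ≤ C) → (∀ (n v w : EuclideanSpace ℝ (Fin 3)), ‖n‖ = 1 → Ψ (-n, (Literature.Analysis.FluidPDE.reflectVel n (v, w)).1, (Literature.Analysis.FluidPDE.reflectVel n (v, w)).2) = -Ψ (n, v, w)) → ∀ η δ : ℝ, 0 < η → 0 < δ → ∃ r₀ : ℝ, 0 < r₀ ∧ ∀ r ϑ : ℝ, 0 < r → r < r₀ → 0 < ϑ → ϑ < r₀ → ∃ N₀ : ℕ, ∀ N : ℕ, N₀ ≤ N → let ε := Literature.MathematicalPhysics.KineticTheory.hsDiameter σ N; let G := Literature.Analysis.FluidPDE.Torus.geometry (Fin 3); let γ := fun z (s : ℝ) => (Φ N).flow s z; let bx : UnitAddTorus (Fin 3) → UnitAddTorus (Fin 3) → ℝ := fun x y => 3 / (Real.pi * r ^ 3) * max (1 - Literature.Analysis.FluidPDE.Torus.euclidDist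 x y / r) 0; let ρm := fun z s (x₀ : UnitAddTorus (Fin 3)) => ∫ q, bx q.1 x₀ ∂(Literature.Analysis.FluidPDE.empiricalMeasure (γ z s)); let hm := fun z s (x₀ : UnitAddTorus (Fin 3)) (v : EuclideanSpace ℝ (Fin 3)) => ∫ q, bx q.1 x₀ * Literature.Analysis.FluidPDE.localMaxwellian 1 (ϑ ^ 2) v q.2 ∂(Literature.Analysis.FluidPDE.empiricalMeasure (γ z s)); let pv := fun z s (i j : Fin (N + 1)) => Literature.Analysis.FluidPDE.reflectVel (G.sepVec (γ z s i).1 (γ z s j).1) ((γ z s i).2, (γ z s j).2); let F := fun z s (i j : Fin (N + 1)) => Real.log (hm z s (γ z s i).1 (pv z s i j).1) + Real.log (hm z s (γ z s i).1 (pv z s i j).2) - Real.log (hm z s (γ z s i).1 (γ z s i).2) - Real.log (hm z s (γ z s i).1 (γ z s j).2); let Kc := fun (Fn : Literature.Analysis.FluidPDE.Config (N + 1) (Fin 3) Literature.MathematicalPhysics.KineticTheory.T3 → ℝ → Fin (N + 1) → Fin (N + 1) → ℝ) z => ε / (N + 1 : ℝ) * ∑ᶠ (s : ℝ) (_ : s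 ∈ Literature.Analysis.FluidPDE.collisionTimes G ε (γ z) ∩ Set.Icc 0 τ), ∑ i : Fin (N + 1), ∑ j : Fin (N + 1), (if i ≠ j ∧ ‖G.sepVec (γ z s i).1 (γ z s j).1‖ = ε then Fn z s i j else 0); let D := fun z => Kc (fun z s i j => χ (s, (γ z s i).1) * g (σ ^ 3 * ρm z s (γ z s i).1) * (Ψ (ε⁻¹ • G.sepVec (γ z s i).1 (γ z s j).1, (pv z s i j).1, (pv z s i j).2) * min 1 (Real.exp (-F z s i j)))) z; Literature.MathematicalPhysics.KineticTheory.localGibbsLaw σ a₀ u₀ θ₀ N (Φ N) {z | η < |D z|} ≤ ENNReal.ofReal δ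

/-- **Upward sandwich**: the frame-free Metropolis statement implies the rev-5 crux (the frame hypotheses are simply
ignored). [folklore] -/
theorem oddContactSymmetryMinAllTimes_imp (h : OddContactSymmetryMinAllTimes) : OddContactSymmetry := by
  obtain ⟨η₀, hη₀, H⟩ := h
  refine ⟨η₀, hη₀, fun a₀ θ₀ u₀ ha hθ hu hpa hpθ => ?_⟩
  obtain ⟨σ₀, hσ₀, Hσ⟩ := H a₀ θ₀ u₀ ha hθ hu hpa hpθ
  exact ⟨σ₀, hσ₀, fun σ hσ hσσ T ρ θ u _ Φ _ τ hτ _ => Hσ σ hσ hσσ Φ τ hτ⟩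

/-- **Rung 0 of the rev-5 crux, every horizon** (landed as `OddContactSymmetryNegative.OddStatRungZeroAllTimes`): the crux
body verbatim at the homogeneous profiles `(1, 0, θ₀)` with NO frame. -/
def OddStatRungZeroAllTimes : Prop :=
  ∃ η₀ : ℝ, 0 < η₀ ∧ ∀ θ₀ : ℝ, 0 < θ₀ → ∃ σ₀ : ℝ, 0 < σ₀ ∧ ∀ σ : ℝ, 0 < σ → σ < σ₀ → ∀ Φ : (N : ℕ) → Literature.Analysis.FluidPDE.HardSphereFlow (Literature.Analysis.FluidPDE.Torus.geometry (Fin 3)) (Literature.MathematicalPhysics.KineticTheory.hsDiameter σ N) (N + 1), ∀ τ : ℝ, 0 < τ → ∀ χ : ℝ × UnitAddTorus (Fin 3) → ℝ, Continuous χ → ∀ g : ℝ → ℝ, Continuous g → (∀ a, η₀ ≤ a → g a = 0) → ∀ Ψ : EuclideanSpace ℝ (Fin 3) × EuclideanSpace ℝ (Fin 3) × EuclideanSpace ℝ (Fin 3) → ℝ, Continuous Ψ → (∃ C : ℝ, ∀ q, |Ψ q| ≤ C) → (∀ (n v w : EuclideanSpace ℝ (Fin 3)), ‖n‖ = 1 →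 Ψ (-n, (Literature.Analysis.FluidPDE.reflectVel n (v, w)).1, (Literature.Analysis.FluidPDE.reflectVel n (v, w)).2) = -Ψ (n, v, w)) → ∀ η δ : ℝ, 0 < η → 0 < δ → ∃ r₀ : ℝ, 0 < r₀ ∧ ∀ r ϑ : ℝ, 0 < r → r < r₀ → 0 < ϑ → ϑ < r₀ → ∃ N₀ : ℕ, ∀ N : ℕ, N₀ ≤ N → let ε := Literature.MathematicalPhysics.KineticTheory.hsDiameter σ N; let G := Literature.Analysis.FluidPDE.Torus.geometry (Fin 3); let γ := fun z (s : ℝ) => (Φ N).flow s z; let bx : UnitAddTorus (Fin 3) → UnitAddTorus (Fin 3) → ℝ := fun x y => 3 / (Real.pi * r ^ 3) * max (1 - Literature.Analysis.FluidPDE.Torus.euclidDist x y / r) 0; let ρm := fun z s (x₀ : UnitAddTorus (Fin 3)) => ∫ q, bx q.1 x₀ ∂(Literature.Analysis.FluidPDE.empiricalMeasure (γ z s)); let hm := fun z s (x₀ : UnitAddTorus (Fin 3)) (v : EuclideanSpace ℝ (Fin 3)) => ∫ q, bx q.1 x₀ * Literature.Analysis.FluidPDE.localMaxwellian 1 (ϑ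 ^ 2) v q.2 ∂(Literature.Analysis.FluidPDE.empiricalMeasure (γ z s)); let pv := fun z s (i j : Fin (N + 1)) => Literature.Analysis.FluidPDE.reflectVel (G.sepVec (γ z s i).1 (γ z s j).1) ((γ z s i).2, (γ z s j).2); let F := fun z s (i j : Fin (N + 1)) => Real.log (hm z s (γ z s i).1 (pv z s i j).1) + Real.log (hm z s (γ z s i).1 (pv z s i j).2) - Real.log (hm z s (γ z s i).1 (γ z s i).2) - Real.log (hm z s (γ z s i).1 (γ z s j).2); let Kc := fun (Fn : Literature.Analysis.FluidPDE.Config (N + 1) (Fin 3) Literature.MathematicalPhysics.KineticTheory.T3 → ℝ → Fin (N + 1) → Fin (N + 1) → ℝ) z => ε / (N + 1 : ℝ) * ∑ᶠ (s : ℝ) (_ : s ∈ Literature.Analysis.FluidPDE.collisionTimes G ε (γ z) ∩ Set.Icc 0 τ), ∑ i : Fin (N + 1), ∑ j : Fin (N + 1), (if i ≠ j ∧ ‖G.sepVec (γ z s i).1 (γ z s j).1‖ = ε then Fn z s i j else 0); let D := fun z => Kc (fun z s i j => χ (s, (γ z s i).1) * g (σ ^ 3 * ρm z s (γ z s i).1)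 * (Ψ (ε⁻¹ • G.sepVec (γ z s i).1 (γ z s j).1, (pv z s i j).1, (pv z s i j).2) * min 1 (Real.exp (-F z s i j)))) z; Literature.MathematicalPhysics.KineticTheory.localGibbsLaw σ (fun _ => 1) (fun _ => 0) (fun _ => θ₀) N (Φ N) {z | η < |D z|} ≤ ENNReal.ofReal δ

/-- **The frame is void at rung 0** (landed as `OddContactSymmetryNegative.oddContactSymmetry_imp_rungZeroAllTimes`):
`T := τ + 1`, the constant solution (`isHardSphereEulerSolution_const`) and the identified `t = 0` LLN
(`homogeneous_lln_identified`). [folklore] -/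
theorem oddContactSymmetry_imp_rungZeroAllTimes (h : OddContactSymmetry) : OddStatRungZeroAllTimes := by
  obtain ⟨η₀, hη₀, H⟩ := h
  refine ⟨η₀, hη₀, fun θ₀ hθ₀ => ?_⟩
  obtain ⟨σ₀, hσ₀, Hσ⟩ := H (fun _ => 1) (fun _ => θ₀) (fun _ => 0) continuous_const continuous_const
    continuous_const (fun _ => one_pos) (fun _ => hθ₀)
  obtain ⟨σ₁, hσ₁, -, hL⟩ := Theorems.LocalSecondLawNegative.homogeneous_lln_identified hθ₀
  refine ⟨min σ₀ σ₁, lt_min hσ₀ hσ₁, fun σ hσ hσlt Φ τ hτ => ?_⟩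
  have hσ0 : σ < σ₀ := lt_of_lt_of_le hσlt (min_le_left _ _)
  have hσ1 : σ < σ₁ := lt_of_lt_of_le hσlt (min_le_right _ _)
  exact Hσ σ hσ hσ0 (τ + 1) (fun _ _ => 1) (fun _ _ => θ₀) (fun _ _ => 0)
    (Theorems.DenseExcursionUntied.isHardSphereEulerSolution_const σ (τ + 1) (0 : V3) one_pos hθ₀) Φ (hL σ hσ hσ1 Φ) τ hτ
    (by linarith)

/-- **Rung ½: the rev-5 crux along the stationary shear, every horizon** (landed as
`OddContactSymmetryNegative.OddStatShearAllTimes`): the crux body verbatim at the profiles `(1, sin(2π x₁) e₀, 1)` with NO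
frame. -/
def OddStatShearAllTimes : Prop :=
  ∃ η₀ : ℝ, 0 < η₀ ∧ ∃ σ₀ : ℝ, 0 < σ₀ ∧ ∀ σ : ℝ, 0 < σ → σ < σ₀ → ∀ Φ : (N : ℕ) → Literature.Analysis.FluidPDE.HardSphereFlow (Literature.Analysis.FluidPDE.Torus.geometry (Fin 3)) (Literature.MathematicalPhysics.KineticTheory.hsDiameter σ N) (N + 1), ∀ τ : ℝ, 0 < τ → ∀ χ : ℝ × UnitAddTorus (Fin 3) → ℝ, Continuous χ → ∀ g : ℝ → ℝ, Continuous g → (∀ a, η₀ ≤ a → g a = 0) → ∀ Ψ : EuclideanSpace ℝ (Fin 3) × EuclideanSpace ℝ (Fin 3) × EuclideanSpace ℝ (Fin 3) → ℝ, Continuous Ψ → (∃ C : ℝ, ∀ q, |Ψ q| ≤ C) → (∀ (n v w : EuclideanSpace ℝ (Fin 3)), ‖n‖ = 1 → Ψ (-n, (Literature.Analysis.FluidPDE.reflectVel n (v, w)).1, (Literature.Analysis.FluidPDE.reflectVel n (v, w)).2) = -Ψ (n, v, w)) → ∀ η δ : ℝ, 0 < η → 0 < δ → ∃ r₀ : ℝ,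 0 < r₀ ∧ ∀ r ϑ : ℝ, 0 < r → r < r₀ → 0 < ϑ → ϑ < r₀ → ∃ N₀ : ℕ, ∀ N : ℕ, N₀ ≤ N → let ε := Literature.MathematicalPhysics.KineticTheory.hsDiameter σ N; let G := Literature.Analysis.FluidPDE.Torus.geometry (Fin 3); let γ := fun z (s : ℝ) => (Φ N).flow s z; let bx : UnitAddTorus (Fin 3) → UnitAddTorus (Fin 3) → ℝ := fun x y => 3 / (Real.pi * r ^ 3) * max (1 - Literature.Analysis.FluidPDE.Torus.euclidDist x y / r) 0; let ρm := fun z s (x₀ : UnitAddTorus (Fin 3)) => ∫ q, bx q.1 x₀ ∂(Literature.Analysis.FluidPDE.empiricalMeasure (γ z s)); let hm := fun z s (x₀ : UnitAddTorus (Fin 3)) (v : EuclideanSpace ℝ (Fin 3)) => ∫ q, bx q.1 x₀ * Literature.Analysis.FluidPDE.localMaxwellian 1 (ϑ ^ 2) v q.2 ∂(Literature.Analysis.FluidPDE.empiricalMeasure (γ z s)); let pv := fun z s (i j : Fin (N + 1)) => Literature.Analysis.FluidPDE.reflectVel (G.sepVec (γ z s i).1 (γ z s j).1) ((γ z s i).2,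 (γ z s j).2); let F := fun z s (i j : Fin (N + 1)) => Real.log (hm z s (γ z s i).1 (pv z s i j).1) + Real.log (hm z s (γ z s i).1 (pv z s i j).2) - Real.log (hm z s (γ z s i).1 (γ z s i).2) - Real.log (hm z s (γ z s i).1 (γ z s j).2); let Kc := fun (Fn : Literature.Analysis.FluidPDE.Config (N + 1) (Fin 3) Literature.MathematicalPhysics.KineticTheory.T3 → ℝ → Fin (N + 1) → Fin (N + 1) → ℝ) z => ε / (N + 1 : ℝ) * ∑ᶠ (s : ℝ) (_ : s ∈ Literature.Analysis.FluidPDE.collisionTimes G ε (γ z) ∩ Set.Icc 0 τ), ∑ i : Fin (N + 1), ∑ j : Fin (N + 1), (if i ≠ j ∧ ‖G.sepVec (γ z s i).1 (γ z s j).1‖ = ε then Fn z s i j else 0); let D := fun z => Kc (fun z s i j => χ (s, (γ z s i).1) * g (σ ^ 3 * ρm z s (γ z s i).1) * (Ψ (ε⁻¹ • G.sepVec (γ z s i).1 (γ z s j).1, (pv z s i j).1, (pv z s i j).2) * min 1 (Real.exp (-F z s i j)))) z; Literature.MathematicalPhysics.KineticTheory.localGibbsLaw σ (fun _ => 1) Summit.AtomisticToContinuum.HydrodynamicLimit.Theorems.HydroLimitInBandNegative.shearVelocity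 (fun _ => 1) N (Φ N) {z | η < |D z|} ≤ ENNReal.ofReal δ

/-- **The frame is void along the shear** (landed as `OddContactSymmetryNegative.oddContactSymmetry_imp_shearAllTimes`):
`T := τ + 1`, `isHardSphereEulerSolution_shear`, `shear_tied`. [folklore] -/
theorem oddContactSymmetry_imp_shearAllTimes (h : OddContactSymmetry) : OddStatShearAllTimes := by
  obtain ⟨η₀, hη₀, H⟩ := h
  refine ⟨η₀, hη₀, ?_⟩
  obtain ⟨σ₀, hσ₀, Hσ⟩ := H (fun _ => 1) (fun _ => 1) Theorems.HydroLimitInBandNegative.shearVelocity continuous_const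
    continuous_const Theorems.HydroLimitInBandNegative.continuous_shearVelocity (fun _ => one_pos) (fun _ => one_pos)
  obtain ⟨σ₁, hσ₁, -, hL⟩ := Theorems.HydroLimitInBandNegative.shear_tied
  refine ⟨min σ₀ σ₁, lt_min hσ₀ hσ₁, fun σ hσ hσlt Φ τ hτ => ?_⟩
  have hσ0 : σ < σ₀ := lt_of_lt_of_le hσlt (min_le_left _ _)
  have hσ1 : σ < σ₁ := lt_of_lt_of_le hσlt (min_le_right _ _)
  exact Hσ σ hσ hσ0 (τ + 1) (fun _ _ => 1) (fun _ _ => 1) (fun _ x => Theorems.HydroLimitInBandNegative.shearVelocity x)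
    (Theorems.HydroLimitInBandNegative.isHardSphereEulerSolution_shear σ (τ + 1)) Φ (hL σ hσ hσ1 Φ) τ hτ (by linarith)

/-- **The sandwich, packaged**: the rev-5 crux implies both frame-free members; a counterexample to either (equilibrium at
any horizon, or shear data at any horizon) refutes it. [folklore] -/
theorem not_oddContactSymmetry_of_not_frameFree (h : ¬ OddStatRungZeroAllTimes ∨ ¬ OddStatShearAllTimes) :
    ¬ OddContactSymmetry := fun hc =>
  h.elim (fun h0 => h0 (oddContactSymmetry_imp_rungZeroAllTimes hc)) (fun h1 => h1 (oddContactSymmetry_imp_shearAllTimes hc))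

end

end Summit.AtomisticToContinuum.HydrodynamicLimit.Cruxes.OddContactSymmetry.Disproof
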